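import Literature.Analysis.FluidPDE.TaoSpeedIntegral
import Literature.Analysis.FluidPDE.TaoMovingCutoff
import Literature.Analysis.FluidPDE.TaoEnstrophyLocalisation
import Literature.Analysis.FluidPDE.SpaceTimeCalculus
import Literature.Analysis.FluidPDE.VorticityCalculus
import Literature.Analysis.FluidPDE.TaoEnergyLocalisation
import HarnessLib

/-!
# Tao (2011/2013), proof of Thm. 10.1: the localised enstrophy `W(t)` along the moving cutoff

Proved bricks for the §10 argument (arXiv:1108.1165, pp. 30–31) in the annular geometry of
Remark 10.6: the localised enstrophy `W(t) = ½∫|ω(t,x)|²η(t,x) dx` ((10.15)) and the dissipation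
`Y₁(t) = ∫|∇ω(t,x)|²η(t,x) dx` (`|∇ω|²` the squared Frobenius norm `Σⱼ|∂ⱼω|²`, which dominates
the squared operator norm of the vendored Thm. 10.1) for the moving Lipschitz cutoff
`η = NS.movingCutoff`
(`TaoMovingCutoff.lean`) with radii `R₁' + σ(t)/c`, `R₂' − σ(t)/c` driven by an absolutely
continuous nondecreasing `σ` (in §10 the speed integral `σ(t) = ∫₀ᵗ‖u‖_{L^∞}`,
`TaoSpeedIntegral.lean`), for a field `u` jointly smooth on the closed slab `[0, T] × ℝ³`.
Tao: "As `u` is almost smooth, `W` is `C¹_t`. As in Section 8, we will compute the derivative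
`∂ₜW` […] `∂ₜW = −Y₁ − Y₂ + Y₃ + Y₄ + Y₅ + Y₆`" ((10.11)). Since `σ` is only absolutely continuous,
`W` is only absolutely continuous, and we establish the **kinematic half of (10.11) in integrated
form**:

* `NS.localisedEnstrophy_movingCutoff_sub_eq` — for `0 ≤ s ≤ t ≤ T`,
  `W(t) − W(s) = ∫ₛᵗ ( ∫⟨ω, ∂ₜω⟩(τ) η(τ) dx − (k/c) σ'(τ) · ½∫_{layers(τ)} |ω(τ)|² dx ) dτ`,
  where the second term is Tao's recession term `−Y₂ = ½∫|ω|²∂ₜη ≤ 0` (the cutoff recedes at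
  speed `σ'/c` across the two transition layers, on which `|∇η| = k`; cf. (10.12)) and the first
  is the production against the frozen cutoff, which the vorticity equation and integration by
  parts in `x` (not done here) turn into `−Y₁ + Y₃ + Y₄ + Y₅ + Y₆`;

assembled from

* `NS.hasDerivAt_diagonal` — chain rule on the diagonal for `W(t) = Ψ(t, t)`,
  `Ψ(τ₁, τ₂) = ½∫|ω(τ₁)|²η(τ₂)`;
* `NS.hasDerivAt_localisedEnstrophy_frozen` — `∂₁Ψ = ∫⟨ω, ∂ₜω⟩η` (differentiation under the
  integral sign, `∂ₜω = curl ∂ₜu` at interior times: `NS.hasDerivAt_curl_slice`), with joint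
  continuity `NS.continuousOn_integral_enstrophyProduction_movingCutoff`;
* `NS.hasDerivAt_integral_mul_movingCutoff_param` — the recession derivative
  `d/ds ∫ g η_s = −(k/c)∫_{layers(s)} g` (Lipschitz domination; the kinks of the ramp lie on four
  Lebesgue-null spheres), whence `∂₂Ψ` by the chain rule with `σ`
  (`NS.hasDerivAt_localisedEnstrophy_movingCutoff`: the derivative of `W` at every time where
  `σ` is differentiable);
* `NS.absolutelyContinuousOnInterval_localisedEnstrophy_movingCutoff` — `W` is absolutely
  continuous (`W = Φ(t, σ(t))` with `Φ` Lipschitz on `[0,T] × [0,M]`: Lipschitz in `t` by the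
  mean value inequality for the slice derivatives on the closed slab,
  `NS.exists_lipschitz_curl_slab`, and in the radius by the Lipschitz dependence of the ramp),
  so that the fundamental theorem of calculus for absolutely continuous functions applies;

together with the elementary comparisons used at the two ends of the argument: the initial bound
`2W(0) ≤ ‖ω₀‖²_{L²(annulus)}` ((10.16), `NS.ofReal_two_mul_localisedEnstrophy_le`) and the
extraction of the conclusion of Thm. 10.1 on the plateau annulus where `η = 1` ((10.17),
`NS.setLIntegral_curl_sq_le_ofReal_localisedEnstrophy`,
`NS.setLIntegral_fderiv_curl_sq_le_ofReal_dissipation`), continuity of `t ↦ W(t)`, `t ↦ Y₁(t)`,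
and small absolute-continuity lemmas (`LipschitzOnWith.comp_absolutelyContinuousOnInterval`,
`AbsolutelyContinuousOnInterval.prodMk`).

## Mathlib / tree search

Tree: `Fluid.IsClassicalNSSolutionOn.enstrophy_balance_cutoff_sub` (`NSVorticityDifference.lean`)
is the time-integrated enstrophy balance for a *static* `C¹_c` cutoff; nothing for moving or
Lipschitz cutoffs (`lean search 'movingCutoff|localisedEnstrophy|diagonal'`). Mathlib:
`hasDerivAt_integral_of_dominated_loc_of_lip`, `hasDerivAt_integral_of_dominated_loc_of_deriv_le`,
`continuousOn_integral_of_compact_support`, `Measure.addHaar_sphere`,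
`Convex.lipschitzOnWith_of_nnnorm_hasDerivWithin_le`, `AbsolutelyContinuousOnInterval.*`
(`integral_deriv_eq_sub`), `exists_hasDerivAt_eq_slope`, `HasDerivAt.norm_sq`.

## References

* T. Tao, *Localisation and compactness properties of the Navier–Stokes global regularity
  problem*, Anal. PDE 6 (2013) 25–107 = arXiv:1108.1165 (`Tao2011`), §10, proof of Thm. 10.1
  ((10.11)–(10.17), arXiv p. 31), Remark 10.6 (arXiv Rem. 64, p. 33).
-/


noncomputable section

open MeasureTheory Set Function Filter Topology intervalIntegral
open scoped ENNReal NNReal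

/-! ## Absolute continuity under Lipschitz maps -/

section AC

variable {X Y : Type*} [PseudoMetricSpace X] [PseudoMetricSpace Y]

open AbsolutelyContinuousOnInterval in
/-- A Lipschitz map (on a set containing the range) preserves absolute continuity on an
interval. [folklore] -/
theorem LipschitzOnWith.comp_absolutelyContinuousOnInterval {K : ℝ≥0} {φ : X → Y} {s : Set X}
    (hφ : LipschitzOnWith K φ s) {f : ℝ → X} {a b : ℝ} (hf : AbsolutelyContinuousOnInterval f a b)
    (hmaps : MapsTo f (uIcc a b) s) : AbsolutelyContinuousOnInterval (φ ∘ f) a b := by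
  unfold AbsolutelyContinuousOnInterval at hf ⊢
  have hev : ∀ᶠ E : ℕ × (ℕ → ℝ × ℝ) in totalLengthFilter ⊓ 𝓟 (disjWithin a b),
      E ∈ disjWithin a b :=
    eventually_inf_principal.mpr (Eventually.of_forall fun _ h => h)
  refine squeeze_zero' (Eventually.of_forall fun E => Finset.sum_nonneg fun _ _ => dist_nonneg)
    (hev.mono fun E hE => ?_) (by simpa using hf.const_mul (K : ℝ))
  rw [Finset.mul_sum]
  refine Finset.sum_le_sum fun i hi => ?_
  obtain ⟨hmem, -⟩ := hE
  have hi' := hmem i hi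
  exact hφ.dist_le_mul _ (hmaps hi'.1) _ (hmaps hi'.2)

/-- A Lipschitz map preserves absolute continuity on an interval. [folklore] -/
theorem LipschitzWith.comp_absolutelyContinuousOnInterval {K : ℝ≥0} {φ : X → Y}
    (hφ : LipschitzWith K φ) {f : ℝ → X} {a b : ℝ} (hf : AbsolutelyContinuousOnInterval f a b) :
    AbsolutelyContinuousOnInterval (φ ∘ f) a b :=
  hφ.lipschitzOnWith.comp_absolutelyContinuousOnInterval hf (mapsTo_univ _ _)

/-- Pairs of absolutely continuous functions are absolutely continuous (into the product). [folklore] -/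
theorem AbsolutelyContinuousOnInterval.prodMk {f : ℝ → X} {g : ℝ → Y} {a b : ℝ}
    (hf : AbsolutelyContinuousOnInterval f a b) (hg : AbsolutelyContinuousOnInterval g a b) :
    AbsolutelyContinuousOnInterval (fun t => (f t, g t)) a b := by
  unfold AbsolutelyContinuousOnInterval at hf hg ⊢
  refine squeeze_zero' (Eventually.of_forall fun E => Finset.sum_nonneg fun _ _ => dist_nonneg)
    (Eventually.of_forall fun E => ?_) (by simpa using hf.add hg)
  rw [← Finset.sum_add_distrib]
  exact Finset.sum_le_sum fun i _ => max_le_add_of_nonneg dist_nonneg dist_nonneg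

/-- The identity is absolutely continuous on every interval. [folklore] -/
theorem absolutelyContinuousOnInterval_id (a b : ℝ) :
    AbsolutelyContinuousOnInterval (fun t : ℝ => t) a b :=
  (LipschitzWith.id.lipschitzOnWith (s := uIcc a b)).absolutelyContinuousOnInterval

end AC

/-! ## The chain rule on the diagonal -/

/-- **Chain rule on the diagonal.** Let `Ψ : ℝ → ℝ → ℝ`. If near `(τ, τ)` the partial maps
`τ₁ ↦ Ψ τ₁ τ₂` are differentiable with derivative `Ψ₁ τ₁ τ₂` jointly continuous at `(τ, τ)`,
and `τ₂ ↦ Ψ τ τ₂` has derivative `D₂` at `τ`, then `s ↦ Ψ s s` has derivative `Ψ₁ τ τ + D₂` at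
`τ` (mean value theorem in the first variable). Used with `Ψ τ₁ τ₂ = ½∫|ω(τ₁)|²η(τ₂)`: the
first partial is the enstrophy production against a frozen cutoff, the second the recession
term `−Y₂`, which exists wherever the speed integral is differentiable. [folklore] -/
theorem hasDerivAt_diagonal {Ψ Ψ₁ : ℝ → ℝ → ℝ} {τ D₂ : ℝ}
    (h₁ : ∀ᶠ q in 𝓝 ((τ, τ) : ℝ × ℝ), HasDerivAt (fun τ₁ => Ψ τ₁ q.2) (Ψ₁ q.1 q.2) q.1)
    (hc : ContinuousAt (uncurry Ψ₁) (τ, τ)) (h₂ : HasDerivAt (fun τ₂ => Ψ τ τ₂) D₂ τ) :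
    HasDerivAt (fun s => Ψ s s) (Ψ₁ τ τ + D₂) τ := by
  -- split `Ψ s s = (Ψ s s - Ψ τ s) + Ψ τ s`
  have hsplit : (fun s => Ψ s s) = fun s => (Ψ s s - Ψ τ s) + Ψ τ s := by
    funext s; ring
  rw [hsplit]
  refine HasDerivAt.add ?_ h₂
  -- the first summand: `A s = Ψ s s - Ψ τ s`, `A τ = 0`, derivative `Ψ₁ τ τ` by the MVT
  rw [hasDerivAt_iff_isLittleO, Asymptotics.isLittleO_iff]
  intro ε hε
  -- neighbourhoods: differentiability on a square, continuity of `Ψ₁`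
  obtain ⟨δ₁, hδ₁, hdiff⟩ : ∃ δ > 0, ∀ a b : ℝ, |a - τ| < δ → |b - τ| < δ →
      HasDerivAt (fun τ₁ => Ψ τ₁ b) (Ψ₁ a b) a := by
    obtain ⟨δ, hδ, h⟩ := Metric.eventually_nhds_iff.1 h₁
    refine ⟨δ, hδ, fun a b ha hb => h (y := (a, b)) ?_⟩
    rw [Prod.dist_eq, Real.dist_eq, Real.dist_eq]
    exact max_lt ha hb
  obtain ⟨δ₂, hδ₂, hcont⟩ : ∃ δ > 0, ∀ a b : ℝ, |a - τ| < δ → |b - τ| < δ →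
      |Ψ₁ a b - Ψ₁ τ τ| ≤ ε := by
    obtain ⟨δ, hδ, h⟩ := Metric.continuousAt_iff.1 hc ε hε
    refine ⟨δ, hδ, fun a b ha hb => ?_⟩
    have := h (x := (a, b)) (by rw [Prod.dist_eq, Real.dist_eq, Real.dist_eq]; exact max_lt ha hb)
    rw [Real.dist_eq] at this
    exact this.le
  have hδ : 0 < min δ₁ δ₂ := lt_min hδ₁ hδ₂
  refine Metric.eventually_nhds_iff.2 ⟨min δ₁ δ₂, hδ, fun s hs => ?_⟩
  rw [Real.dist_eq] at hs
  have hs₁ : |s - τ| < δ₁ := hs.trans_le (min_le_left _ _)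
  have hs₂ : |s - τ| < δ₂ := hs.trans_le (min_le_right _ _)
  simp only [sub_self, sub_zero, smul_eq_mul, Real.norm_eq_abs]
  -- goal: |Ψ s s - Ψ τ s - (s - τ) * Ψ₁ τ τ| ≤ ε * |s - τ|
  rcases lt_trichotomy τ s with hlt | heq | hgt
  · -- MVT on `[τ, s]` for `g = Ψ · s`
    have hg : ∀ x ∈ Icc τ s, HasDerivAt (fun τ₁ => Ψ τ₁ s) (Ψ₁ x s) x := fun x hx =>
      hdiff x s (by rw [abs_lt]; constructor <;> linarith [hx.1, hx.2, abs_lt.1 hs₁]) hs₁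
    obtain ⟨ξ, hξ, hξeq⟩ := exists_hasDerivAt_eq_slope (fun τ₁ => Ψ τ₁ s) (fun x => Ψ₁ x s) hlt
      (fun x hx => (hg x hx).continuousAt.continuousWithinAt) (fun x hx => hg x (Ioo_subset_Icc_self hx))
    have hξ₁ : |ξ - τ| < δ₁ := by
      rw [abs_lt]; constructor <;> linarith [hξ.1, hξ.2, abs_lt.1 hs₁]
    have hξ₂ : |ξ - τ| < δ₂ := by
      rw [abs_lt]; constructor <;> linarith [hξ.1, hξ.2, abs_lt.1 hs₂]
    have hne : s - τ ≠ 0 := sub_ne_zero.2 hlt.ne'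
    have hmv : Ψ s s - Ψ τ s = Ψ₁ ξ s * (s - τ) := by
      rw [hξeq, div_mul_cancel₀ _ hne]
    rw [hmv, show Ψ₁ ξ s * (s - τ) - (s - τ) * Ψ₁ τ τ = (Ψ₁ ξ s - Ψ₁ τ τ) * (s - τ) by ring,
      abs_mul]
    exact mul_le_mul_of_nonneg_right (hcont ξ s hξ₂ hs₂) (abs_nonneg _)
  · subst heq
    simp
  · -- MVT on `[s, τ]`
    have hg : ∀ x ∈ Icc s τ, HasDerivAt (fun τ₁ => Ψ τ₁ s) (Ψ₁ x s) x := fun x hx =>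
      hdiff x s (by rw [abs_lt]; constructor <;> linarith [hx.1, hx.2, abs_lt.1 hs₁]) hs₁
    obtain ⟨ξ, hξ, hξeq⟩ := exists_hasDerivAt_eq_slope (fun τ₁ => Ψ τ₁ s) (fun x => Ψ₁ x s) hgt
      (fun x hx => (hg x hx).continuousAt.continuousWithinAt) (fun x hx => hg x (Ioo_subset_Icc_self hx))
    have hξ₁ : |ξ - τ| < δ₁ := by
      rw [abs_lt]; constructor <;> linarith [hξ.1, hξ.2, abs_lt.1 hs₁]
    have hξ₂ : |ξ - τ| < δ₂ := by
      rw [abs_lt]; constructor <;> linarith [hξ.1, hξ.2, abs_lt.1 hs₂]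
    have hne : τ - s ≠ 0 := sub_ne_zero.2 hgt.ne'
    have hmv : Ψ τ s - Ψ s s = Ψ₁ ξ s * (τ - s) := by
      rw [hξeq, div_mul_cancel₀ _ hne]
    rw [show Ψ s s - Ψ τ s - (s - τ) * Ψ₁ τ τ = -((Ψ τ s - Ψ s s) - (τ - s) * Ψ₁ τ τ) by ring,
      abs_neg, hmv,
      show Ψ₁ ξ s * (τ - s) - (τ - s) * Ψ₁ τ τ = (Ψ₁ ξ s - Ψ₁ τ τ) * (τ - s) by ring, abs_mul,
      abs_sub_comm τ s]
    exact mul_le_mul_of_nonneg_right (hcont ξ s hξ₂ hs₂) (abs_nonneg _)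

namespace Literature.Analysis.FluidPDE

/-- Local notation for physical space `ℝ³ = EuclideanSpace ℝ (Fin 3)`. -/
local notation "ℝ³" => EuclideanSpace ℝ (Fin 3)

/-! ## The localised enstrophy and its dissipation -/

/-- **Localised enstrophy** `W = ½∫|ω|²η` of a velocity field `v` (`ω = curl v`) against a
weight `η` (Tao's (10.15) with `η = η(t, ·)` the moving cutoff). [cite: Tao2011, §10, proof of Thm. 10.1 ((10.15))] -/
def localisedEnstrophy (η : ℝ³ → ℝ) (v : ℝ³ → ℝ³) : ℝ :=
  (1 / 2) * ∫ x, ‖FluidPDE.curl v x‖ ^ 2 * η x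

/-- **Localised enstrophy dissipation** `Y₁ = ∫|∇ω|²η` (Tao's dissipation term `Y₁`), with
`|∇ω|² = Σⱼ|∂ⱼω|²` the squared Frobenius norm of `D(curl v)` (`Fluid.frobeniusNormSq`, the form
the enstrophy identity produces; it dominates the squared operator norm used in the conclusion of
the vendored Thm. 10.1, `Fluid.sq_opNorm_le_frobeniusNormSq`). [cite: Tao2011, §10, proof of Thm. 10.1 (the term Y₁)] -/
def localisedEnstrophyDissipation (η : ℝ³ → ℝ) (v : ℝ³ → ℝ³) : ℝ :=
  ∫ x, FluidPDE.frobeniusNormSq (fderiv ℝ (FluidPDE.curl v) x) * η x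

/-- Unfolding `localisedEnstrophy`. [folklore] -/
theorem localisedEnstrophy_def (η : ℝ³ → ℝ) (v : ℝ³ → ℝ³) :
    localisedEnstrophy η v = (1 / 2) * ∫ x, ‖FluidPDE.curl v x‖ ^ 2 * η x := rfl

/-- Unfolding `localisedEnstrophyDissipation`. [folklore] -/
theorem localisedEnstrophyDissipation_def (η : ℝ³ → ℝ) (v : ℝ³ → ℝ³) :
    localisedEnstrophyDissipation η v =
      ∫ x, FluidPDE.frobeniusNormSq (fderiv ℝ (FluidPDE.curl v) x) * η x := rfl

/-- `W ≥ 0` for a nonnegative weight. [folklore] -/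
theorem localisedEnstrophy_nonneg {η : ℝ³ → ℝ} (hη : ∀ x, 0 ≤ η x) (v : ℝ³ → ℝ³) :
    0 ≤ localisedEnstrophy η v :=
  mul_nonneg (by norm_num) (integral_nonneg fun x => mul_nonneg (sq_nonneg _) (hη x))

/-- `Y₁ ≥ 0` for a nonnegative weight. [folklore] -/
theorem localisedEnstrophyDissipation_nonneg {η : ℝ³ → ℝ} (hη : ∀ x, 0 ≤ η x) (v : ℝ³ → ℝ³) :
    0 ≤ localisedEnstrophyDissipation η v :=
  integral_nonneg fun x => mul_nonneg (FluidPDE.frobeniusNormSq_nonneg _) (hη x)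

/-! ## Comparison with set integrals: initial bound and extraction -/

/-- A weight in `[0, 1]` vanishing off `S` is dominated by the indicator of `S`:
`∫ g η ≤ ∫_S g` for `g ≥ 0`, in the `ℝ≥0∞`-valued form matching the hypotheses of Thm. 10.1
(no integrability needed on the right). [folklore] -/
theorem ofReal_integral_mul_weight_le_setLIntegral {g η : ℝ³ → ℝ} {S : Set ℝ³}
    (hS : MeasurableSet S) (hg : ∀ x, 0 ≤ g x) (hη0 : ∀ x, 0 ≤ η x) (hη1 : ∀ x, η x ≤ 1)
    (hsupp : ∀ x ∉ S, η x = 0) :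
    ENNReal.ofReal (∫ x, g x * η x) ≤ ∫⁻ x in S, ENNReal.ofReal (g x) := by
  have hnn : ∀ x, 0 ≤ g x * η x := fun x => mul_nonneg (hg x) (hη0 x)
  by_cases hint : Integrable (fun x => g x * η x)
  · rw [ofReal_integral_eq_lintegral_ofReal hint (ae_of_all _ hnn), ← lintegral_indicator hS]
    refine lintegral_mono fun x => ?_
    by_cases hx : x ∈ S
    · rw [indicator_of_mem hx]
      exact ENNReal.ofReal_le_ofReal (by nlinarith [hη1 x, hg x])
    · rw [indicator_of_notMem hx, hsupp x hx, mul_zero, ENNReal.ofReal_zero]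
  · rw [integral_undef hint, ENNReal.ofReal_zero]
    exact zero_le

/-- Conversely, where the weight equals `1`: `∫_P g ≤ ∫ g η` for `g ≥ 0` with `g η` integrable
and `η = 1` on `P`, `η ≥ 0` (extraction of the conclusion of Thm. 10.1 on the plateau annulus
from bounds on `W`, `Y₁`). [folklore] -/
theorem setLIntegral_le_ofReal_integral_mul_weight {g η : ℝ³ → ℝ} {P : Set ℝ³}
    (hP : MeasurableSet P) (hg : ∀ x, 0 ≤ g x) (hη0 : ∀ x, 0 ≤ η x) (hone : ∀ x ∈ P, η x = 1)
    (hint : Integrable (fun x => g x * η x)) :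
    ∫⁻ x in P, ENNReal.ofReal (g x) ≤ ENNReal.ofReal (∫ x, g x * η x) := by
  have hnn : ∀ x, 0 ≤ g x * η x := fun x => mul_nonneg (hg x) (hη0 x)
  rw [ofReal_integral_eq_lintegral_ofReal hint (ae_of_all _ hnn), ← lintegral_indicator hP]
  refine lintegral_mono fun x => ?_
  by_cases hx : x ∈ P
  · rw [indicator_of_mem hx, hone x hx, mul_one]
  · rw [indicator_of_notMem hx]
    exact zero_le

/-- Dictionary: `‖w‖ₑ² = ofReal (‖w‖²)`. [folklore] -/
theorem enorm_sq_eq_ofReal_norm_sq {F : Type*} [NormedAddCommGroup F] (w : F) :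
    ‖w‖ₑ ^ 2 = ENNReal.ofReal (‖w‖ ^ 2) := by
  rw [← ofReal_norm, ENNReal.ofReal_pow (norm_nonneg _)]

/-- **Initial bound (10.16).** If the cutoff lies in `[0, 1]` and vanishes off the source
annulus `S`, then `2W ≤ ‖ω‖²_{L²(S)}`: with (10.1), `W(0) ≤ ½δ²`. [cite: Tao2011, §10, proof of Thm. 10.1 ((10.16))] -/
theorem ofReal_two_mul_localisedEnstrophy_le {η : ℝ³ → ℝ} {v : ℝ³ → ℝ³} {S : Set ℝ³}
    (hS : MeasurableSet S) (hη0 : ∀ x, 0 ≤ η x) (hη1 : ∀ x, η x ≤ 1) (hsupp : ∀ x ∉ S, η x = 0) :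
    ENNReal.ofReal (2 * localisedEnstrophy η v) ≤ ∫⁻ x in S, ‖FluidPDE.curl v x‖ₑ ^ 2 := by
  rw [localisedEnstrophy_def, ← mul_assoc, show (2 : ℝ) * (1 / 2) = 1 by norm_num, one_mul]
  simp_rw [enorm_sq_eq_ofReal_norm_sq]
  exact ofReal_integral_mul_weight_le_setLIntegral hS (fun x => sq_nonneg _) hη0 hη1 hsupp

/-- **Extraction, vorticity.** If `η ≥ 0` equals `1` on the plateau annulus `P` (and `|ω|²η` is
integrable), then `‖ω‖²_{L²(P)} ≤ 2W`. [cite: Tao2011, §10, proof of Thm. 10.1 ((10.17))] -/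
theorem setLIntegral_curl_sq_le_ofReal_localisedEnstrophy {η : ℝ³ → ℝ} {v : ℝ³ → ℝ³} {P : Set ℝ³}
    (hP : MeasurableSet P) (hη0 : ∀ x, 0 ≤ η x) (hone : ∀ x ∈ P, η x = 1)
    (hint : Integrable (fun x => ‖FluidPDE.curl v x‖ ^ 2 * η x)) :
    ∫⁻ x in P, ‖FluidPDE.curl v x‖ₑ ^ 2 ≤ ENNReal.ofReal (2 * localisedEnstrophy η v) := by
  rw [localisedEnstrophy_def, ← mul_assoc, show (2 : ℝ) * (1 / 2) = 1 by norm_num, one_mul]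
  simp_rw [enorm_sq_eq_ofReal_norm_sq]
  exact setLIntegral_le_ofReal_integral_mul_weight hP (fun x => sq_nonneg _) hη0 hone hint

/-- **Extraction, vorticity gradient.** If `η ≥ 0` equals `1` on `P` (and `|∇ω|²_F η` is
integrable), then `‖∇ω‖²_{L²(P)} ≤ Y₁`, the left side with the operator norm of `D(curl v)` as in
the vendored Thm. 10.1 (`‖L‖² ≤ |L|²_F`). [cite: Tao2011, §10, proof of Thm. 10.1 ((10.17))] -/
theorem setLIntegral_fderiv_curl_sq_le_ofReal_dissipation {η : ℝ³ → ℝ} {v : ℝ³ → ℝ³}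
    {P : Set ℝ³} (hP : MeasurableSet P) (hη0 : ∀ x, 0 ≤ η x) (hone : ∀ x ∈ P, η x = 1)
    (hint : Integrable (fun x => FluidPDE.frobeniusNormSq (fderiv ℝ (FluidPDE.curl v) x) * η x)) :
    ∫⁻ x in P, ‖fderiv ℝ (FluidPDE.curl v) x‖ₑ ^ 2 ≤
      ENNReal.ofReal (localisedEnstrophyDissipation η v) := by
  rw [localisedEnstrophyDissipation_def]
  have hle : ∀ x, ‖fderiv ℝ (FluidPDE.curl v) x‖ₑ ^ 2 ≤
      ENNReal.ofReal (FluidPDE.frobeniusNormSq (fderiv ℝ (FluidPDE.curl v) x)) := fun x => by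
    rw [enorm_sq_eq_ofReal_norm_sq]
    exact ENNReal.ofReal_le_ofReal (FluidPDE.sq_opNorm_le_frobeniusNormSq _)
  exact (lintegral_mono fun x => hle x).trans
    (setLIntegral_le_ofReal_integral_mul_weight hP (fun x => FluidPDE.frobeniusNormSq_nonneg _) hη0
      hone hint)



/-! ## Slices of a classical solution against the moving cutoff: integrability and continuity -/

section Solution

variable {T ν : ℝ} {f u : ℝ → ℝ³ → ℝ³} {p : ℝ → ℝ³ → ℝ}

/-- Joint continuity of the curl `(t, x) ↦ curl w(t)(x)` of a jointly smooth field on the closed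
slab. [folklore] -/
theorem continuousOn_curl_slab (hT : 0 < T) {w : ℝ → ℝ³ → ℝ³}
    (hw : FluidPDE.IsSmoothSpaceTimeOn (Icc 0 T) w) :
    ContinuousOn (fun z : ℝ × ℝ³ => FluidPDE.curl (w z.1) z.2) (Icc 0 T ×ˢ univ) := by
  have h := hw.continuousOn_fderiv_slice (uniqueDiffOn_Icc hT)
  exact FluidPDE.curlCLM.continuous.comp_continuousOn h

/-- Joint continuity of the curl gradient `(t, x) ↦ D(curl w(t))(x)` of a jointly smooth field on
the closed slab (slice derivatives of jointly smooth fields are jointly smooth, twice;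
`D(curl v) = curlCLM ∘ D²v`). [folklore] -/
theorem continuousOn_fderiv_curl_slab' (hT : 0 < T) {w : ℝ → ℝ³ → ℝ³}
    (hw : FluidPDE.IsSmoothSpaceTimeOn (Icc 0 T) w) :
    ContinuousOn (fun z : ℝ × ℝ³ => fderiv ℝ (FluidPDE.curl (w z.1)) z.2) (Icc 0 T ×ˢ univ) := by
  have hU : UniqueDiffOn ℝ (Icc 0 T) := uniqueDiffOn_Icc hT
  have h2 : FluidPDE.IsSmoothSpaceTimeOn (Icc 0 T)
      (fun t x => fderiv ℝ (fun y => fderiv ℝ (w t) y) x) :=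
    (hw.fderiv_slice hU).fderiv_slice hU
  have h3 : ContinuousOn (fun z : ℝ × ℝ³ =>
      FluidPDE.curlCLM.comp (fderiv ℝ (fun y => fderiv ℝ (w z.1) y) z.2)) (Icc 0 T ×ˢ univ) :=
    (ContinuousLinearMap.compL ℝ ℝ³ (ℝ³ →L[ℝ] ℝ³) ℝ³ FluidPDE.curlCLM).continuous.comp_continuousOn
      h2.continuousOn
  refine h3.congr ?_
  rintro ⟨t, x⟩ ⟨ht, -⟩
  exact FluidPDE.fderiv_curl ((hw.contDiff_slice ht).of_le (by norm_cast)) x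

variable {x₀ : ℝ³} {k : ℝ} {ρ₁ ρ₂ : ℝ → ℝ}

/-- The enstrophy integrand `|ω(t,x)|²η(t,x)` is jointly continuous on the slab when the radii
are continuous on `[0, T]`. [folklore] -/
theorem continuousOn_curl_sq_mul_movingCutoff (hT : 0 < T)
    (hsol : FluidPDE.IsClassicalNSSolutionOn (Icc 0 T) ν f u p) (k : ℝ)
    (h₁ : ContinuousOn ρ₁ (Icc 0 T)) (h₂ : ContinuousOn ρ₂ (Icc 0 T)) :
    ContinuousOn (uncurry fun t x => ‖FluidPDE.curl (u t) x‖ ^ 2 * movingCutoff x₀ k ρ₁ ρ₂ t x)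
      (Icc 0 T ×ˢ univ) :=
  ((continuousOn_curl_slab hT hsol.smooth_velocity).norm.pow 2).mul
    (continuousOn_movingCutoff_uncurry k h₁ h₂)

/-- The dissipation integrand `|∇ω(t,x)|²_F η(t,x)` is jointly continuous on the slab when the
radii are continuous on `[0, T]`. [folklore] -/
theorem continuousOn_fderiv_curl_sq_mul_movingCutoff (hT : 0 < T)
    (hsol : FluidPDE.IsClassicalNSSolutionOn (Icc 0 T) ν f u p) (k : ℝ)
    (h₁ : ContinuousOn ρ₁ (Icc 0 T)) (h₂ : ContinuousOn ρ₂ (Icc 0 T)) :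
    ContinuousOn (uncurry fun t x =>
      FluidPDE.frobeniusNormSq (fderiv ℝ (FluidPDE.curl (u t)) x) * movingCutoff x₀ k ρ₁ ρ₂ t x)
      (Icc 0 T ×ˢ univ) :=
  (continuous_frobeniusNormSq_clm.comp_continuousOn
    (continuousOn_fderiv_curl_slab' hT hsol.smooth_velocity)).mul
    (continuousOn_movingCutoff_uncurry k h₁ h₂)

/-- Uniform compact support: if the outer radius stays below `R` on `[0, T]`, both integrands
vanish off the closed ball `B̄(x₀, R)` (for `k ≥ 0`). [folklore] -/
theorem mul_movingCutoff_eq_zero_of_notMem (hk : 0 ≤ k) {R : ℝ} {t : ℝ} (hρ₂ : ρ₂ t ≤ R)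
    (g : ℝ³ → ℝ) {x : ℝ³} (hx : x ∉ Metric.closedBall x₀ R) :
    g x * movingCutoff x₀ k ρ₁ ρ₂ t x = 0 := by
  have hx' : x ∉ Metric.ball x₀ (ρ₂ t) \ Metric.closedBall x₀ (ρ₁ t) := fun h =>
    hx (Metric.closedBall_subset_closedBall hρ₂ (Metric.ball_subset_closedBall h.1))
  rw [movingCutoff_eq_zero_of_not_mem hk hx', mul_zero]

/-- **Continuity of the localised enstrophy** `t ↦ W(t) = ½∫|ω(t)|²η(t)` on `[0, T]` for
continuous radii with bounded outer radius ("`W` is `C¹_t`" in Tao's setting; here continuity,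
the time derivative being treated in integrated form). [cite: Tao2011, §10, proof of Thm. 10.1 ((10.15))] -/
theorem continuousOn_localisedEnstrophy_movingCutoff (hT : 0 < T)
    (hsol : FluidPDE.IsClassicalNSSolutionOn (Icc 0 T) ν f u p) (hk : 0 ≤ k)
    (h₁ : ContinuousOn ρ₁ (Icc 0 T)) (h₂ : ContinuousOn ρ₂ (Icc 0 T)) {R : ℝ}
    (hR : ∀ t ∈ Icc 0 T, ρ₂ t ≤ R) :
    ContinuousOn (fun t => localisedEnstrophy (movingCutoff x₀ k ρ₁ ρ₂ t) (u t)) (Icc 0 T) := by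
  have h := FluidPDE.continuousOn_integral_of_support_subset (μ := (volume : Measure ℝ³))
    (isCompact_closedBall x₀ R) (continuousOn_curl_sq_mul_movingCutoff hT hsol k h₁ h₂)
    (fun t ht x hx => mul_movingCutoff_eq_zero_of_notMem (ρ₁ := ρ₁) hk (hR t ht)
      (fun y => ‖FluidPDE.curl (u t) y‖ ^ 2) hx)
  simp only [localisedEnstrophy_def]
  exact continuousOn_const.mul h

/-- **Continuity of the localised dissipation** `t ↦ Y₁(t) = ∫|∇ω(t)|²η(t)` on `[0, T]`. [cite: Tao2011, §10, proof of Thm. 10.1 (the term Y₁)] -/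
theorem continuousOn_localisedEnstrophyDissipation_movingCutoff (hT : 0 < T)
    (hsol : FluidPDE.IsClassicalNSSolutionOn (Icc 0 T) ν f u p) (hk : 0 ≤ k)
    (h₁ : ContinuousOn ρ₁ (Icc 0 T)) (h₂ : ContinuousOn ρ₂ (Icc 0 T)) {R : ℝ}
    (hR : ∀ t ∈ Icc 0 T, ρ₂ t ≤ R) :
    ContinuousOn (fun t => localisedEnstrophyDissipation (movingCutoff x₀ k ρ₁ ρ₂ t) (u t))
      (Icc 0 T) := by
  have h := FluidPDE.continuousOn_integral_of_support_subset (μ := (volume : Measure ℝ³))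
    (isCompact_closedBall x₀ R) (continuousOn_fderiv_curl_sq_mul_movingCutoff hT hsol k h₁ h₂)
    (fun t ht x hx => mul_movingCutoff_eq_zero_of_notMem (ρ₁ := ρ₁) hk (hR t ht)
      (fun y => FluidPDE.frobeniusNormSq (fderiv ℝ (FluidPDE.curl (u t)) y)) hx)
  simpa only [localisedEnstrophyDissipation_def] using h

/-- Integrability of the enstrophy integrand of a slice (continuous with compact support). [folklore] -/
theorem integrable_curl_sq_mul_movingCutoff (hsol : FluidPDE.IsClassicalNSSolutionOn (Icc 0 T) ν f u p)
    (hk : 0 ≤ k) {t : ℝ} (ht : t ∈ Icc 0 T) :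
    Integrable fun x => ‖FluidPDE.curl (u t) x‖ ^ 2 * movingCutoff x₀ k ρ₁ ρ₂ t x := by
  have hc : Continuous fun x => ‖FluidPDE.curl (u t) x‖ ^ 2 * movingCutoff x₀ k ρ₁ ρ₂ t x :=
    ((FluidPDE.continuous_curl ((hsol.contDiff_velocity ht).of_le (by norm_cast))).norm.pow 2).mul
      (continuous_movingCutoff_slice hk x₀ ρ₁ ρ₂ t)
  exact hc.integrable_of_hasCompactSupport
    ((hasCompactSupport_movingCutoff hk).mul_left)

/-- Integrability of the dissipation integrand of a slice. [folklore] -/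
theorem integrable_fderiv_curl_sq_mul_movingCutoff
    (hsol : FluidPDE.IsClassicalNSSolutionOn (Icc 0 T) ν f u p) (hk : 0 ≤ k) {t : ℝ}
    (ht : t ∈ Icc 0 T) :
    Integrable fun x => FluidPDE.frobeniusNormSq (fderiv ℝ (FluidPDE.curl (u t)) x) *
      movingCutoff x₀ k ρ₁ ρ₂ t x := by
  have h3 : ContDiff ℝ 3 (u t) := (hsol.contDiff_velocity ht).of_le (by norm_cast)
  have hcurl2 : ContDiff ℝ 2 (FluidPDE.curl (u t)) := FluidPDE.contDiff_curl (n := 2) h3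
  have hslice : Continuous fun x => FluidPDE.frobeniusNormSq (fderiv ℝ (FluidPDE.curl (u t)) x) :=
    FluidPDE.continuous_frobeniusNormSq_fderiv hcurl2 (by norm_num)
  have hc : Continuous fun x =>
      FluidPDE.frobeniusNormSq (fderiv ℝ (FluidPDE.curl (u t)) x) * movingCutoff x₀ k ρ₁ ρ₂ t x :=
    hslice.mul (continuous_movingCutoff_slice hk x₀ ρ₁ ρ₂ t)
  exact hc.integrable_of_hasCompactSupport ((hasCompactSupport_movingCutoff hk).mul_left)

/-- **Initial condition (10.16)** in the form used by the continuity step: if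
`‖ω₀‖²_{L²(B(x₀,R₂) \ B̄(x₀,R₁))} ≤ δ²`-type bound holds on a measurable set containing the
support annulus of `η(0, ·)`, then `W(0) ≤ ½δ²`. [cite: Tao2011, §10, proof of Thm. 10.1 ((10.16))] -/
theorem localisedEnstrophy_movingCutoff_le_of_setLIntegral_le (hk : 0 ≤ k) {t : ℝ} {S : Set ℝ³}
    (hS : MeasurableSet S) (hSt : Metric.ball x₀ (ρ₂ t) \ Metric.closedBall x₀ (ρ₁ t) ⊆ S)
    {v : ℝ³ → ℝ³} {D : ℝ} (hD : 0 ≤ D)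
    (hω : ∫⁻ x in S, ‖FluidPDE.curl v x‖ₑ ^ 2 ≤ ENNReal.ofReal D) :
    localisedEnstrophy (movingCutoff x₀ k ρ₁ ρ₂ t) v ≤ D / 2 := by
  have h := (ofReal_two_mul_localisedEnstrophy_le (v := v) hS (movingCutoff_nonneg x₀ k ρ₁ ρ₂ t)
    (movingCutoff_le_one x₀ k ρ₁ ρ₂ t)
    (fun x hx => movingCutoff_eq_zero_of_not_mem hk fun h' => hx (hSt h'))).trans hω
  have h2 := (ENNReal.ofReal_le_ofReal_iff hD).1 h
  linarith

end Solution

/-! ## The recession derivative: differentiating `s ↦ ∫ g · η_s` in the radius parameter -/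

section Recession

variable {k c a b : ℝ} {x₀ : ℝ³}

/-- The open transition layers of the cutoff with inner radius `a + s/c` and outer radius
`b − s/c`: `a + s/c < ‖x − x₀‖ < a + s/c + k⁻¹` and `b − s/c − k⁻¹ < ‖x − x₀‖ < b − s/c` (the
region "where `η` is not constant", on which `|∇η| = k` and `∂ₛη = −k/c`). [cite: Tao2011, §10, proof of Thm. 10.1 ((10.12))] -/
def transitionLayers (x₀ : ℝ³) (k c a b s : ℝ) : Set ℝ³ :=
  {x | a + s / c < ‖x - x₀‖ ∧ ‖x - x₀‖ < a + s / c + k⁻¹} ∪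
    {x | b - s / c - k⁻¹ < ‖x - x₀‖ ∧ ‖x - x₀‖ < b - s / c}

/-- The transition layers form an open set. [folklore] -/
theorem isOpen_transitionLayers (x₀ : ℝ³) (k c a b s : ℝ) :
    IsOpen (transitionLayers x₀ k c a b s) := by
  have hn : Continuous fun x : ℝ³ => ‖x - x₀‖ := by fun_prop
  unfold transitionLayers
  exact ((isOpen_lt continuous_const hn).inter (isOpen_lt hn continuous_const)).union
    ((isOpen_lt continuous_const hn).inter (isOpen_lt hn continuous_const))

/-- The transition layers form a measurable set. [folklore] -/
theorem measurableSet_transitionLayers (x₀ : ℝ³) (k c a b s : ℝ) :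
    MeasurableSet (transitionLayers x₀ k c a b s) :=
  (isOpen_transitionLayers x₀ k c a b s).measurableSet

/-- **Pointwise `s`-derivative of the ramp.** Away from the four kink radii, the profile
`s ↦ annularRamp k (a + s/c) (b − s/c) ρ` is differentiable, with derivative `−k/c` on the two
transition layers and `0` elsewhere (both ramps recede as `s` grows). [cite: Tao2011, §10, proof of Thm. 10.1 ((10.12))] -/
theorem hasDerivAt_annularRamp_param (hk : 0 < k) {s₀ ρ : ℝ}
    (hgap : a + s₀ / c + k⁻¹ < b - s₀ / c - k⁻¹)
    (h1 : ρ ≠ a + s₀ / c) (h2 : ρ ≠ a + s₀ / c + k⁻¹) (h3 : ρ ≠ b - s₀ / c - k⁻¹)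
    (h4 : ρ ≠ b - s₀ / c) :
    HasDerivAt (fun s => annularRamp k (a + s / c) (b - s / c) ρ)
      (if (a + s₀ / c < ρ ∧ ρ < a + s₀ / c + k⁻¹) ∨ (b - s₀ / c - k⁻¹ < ρ ∧ ρ < b - s₀ / c)
        then -(k / c) else 0) s₀ := by
  have hA : Continuous fun s : ℝ => a + s / c := by fun_prop
  have hB : Continuous fun s : ℝ => b - s / c := by fun_prop
  have hkinv : 0 < k⁻¹ := inv_pos.2 hk
  -- the two affine branches and their derivatives
  have hinner : HasDerivAt (fun s : ℝ => k * (ρ - (a + s / c))) (-(k / c)) s₀ := by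
    have h := (((hasDerivAt_id s₀).div_const c).const_add a).const_sub ρ |>.const_mul k
    refine h.congr_deriv ?_
    ring
  have houter : HasDerivAt (fun s : ℝ => k * (b - s / c - ρ)) (-(k / c)) s₀ := by
    have h := (((hasDerivAt_id s₀).div_const c).const_sub b).sub_const ρ |>.const_mul k
    refine h.congr_deriv ?_
    ring
  -- five regions
  rcases lt_or_gt_of_ne h1 with r1 | r1
  · -- `ρ < a + s₀/c`: locally zero
    have hev : ∀ᶠ s in 𝓝 s₀, annularRamp k (a + s / c) (b - s / c) ρ = 0 := by
      filter_upwards [(continuous_const.continuousAt).eventually_lt hA.continuousAt r1] with s hs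
      exact annularRamp_eq_zero_of_le_inner hk.le hs.le
    rw [if_neg (by push Not; exact ⟨fun h => absurd (r1.trans h) (lt_irrefl _), fun h => by linarith⟩)]
    exact (hasDerivAt_const s₀ (0 : ℝ)).congr_of_eventuallyEq hev
  rcases lt_or_gt_of_ne h2 with r2 | r2
  · -- inner layer
    have hev : ∀ᶠ s in 𝓝 s₀, annularRamp k (a + s / c) (b - s / c) ρ = k * (ρ - (a + s / c)) := by
      filter_upwards [hA.continuousAt.eventually_lt continuous_const.continuousAt r1,
        (continuous_const.continuousAt).eventually_lt (hA.add continuous_const).continuousAt r2,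
        (continuous_const.continuousAt).eventually_lt (hB.sub continuous_const).continuousAt
          (r2.trans hgap)] with s hs1 hs2 hs3
      exact annularRamp_eq_inner hk hs1.le hs2.le hs3.le
    rw [if_pos (Or.inl ⟨r1, r2⟩)]
    exact hinner.congr_of_eventuallyEq hev
  rcases lt_or_gt_of_ne h3 with r3 | r3
  · -- plateau
    have hev : ∀ᶠ s in 𝓝 s₀, annularRamp k (a + s / c) (b - s / c) ρ = 1 := by
      filter_upwards [(hA.add continuous_const).continuousAt.eventually_lt
          continuous_const.continuousAt r2,
        (continuous_const.continuousAt).eventually_lt (hB.sub continuous_const).continuousAt r3]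
        with s hs1 hs2
      exact annularRamp_eq_one hk hs1.le hs2.le
    rw [if_neg (by push Not; exact ⟨fun _ => r2.le, fun h => absurd (h.trans r3) (lt_irrefl _)⟩)]
    exact (hasDerivAt_const s₀ (1 : ℝ)).congr_of_eventuallyEq hev
  rcases lt_or_gt_of_ne h4 with r4 | r4
  · -- outer layer
    have hev : ∀ᶠ s in 𝓝 s₀, annularRamp k (a + s / c) (b - s / c) ρ = k * (b - s / c - ρ) := by
      filter_upwards [(hA.add continuous_const).continuousAt.eventually_lt
          continuous_const.continuousAt (hgap.trans r3),
        (hB.sub continuous_const).continuousAt.eventually_lt continuous_const.continuousAt r3,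
        (continuous_const.continuousAt).eventually_lt hB.continuousAt r4] with s hs1 hs2 hs3
      exact annularRamp_eq_outer hk hs1.le hs2.le hs3.le
    rw [if_pos (Or.inr ⟨r3, r4⟩)]
    exact houter.congr_of_eventuallyEq hev
  · -- `ρ > b − s₀/c`: locally zero
    have hev : ∀ᶠ s in 𝓝 s₀, annularRamp k (a + s / c) (b - s / c) ρ = 0 := by
      filter_upwards [hB.continuousAt.eventually_lt continuous_const.continuousAt r4] with s hs
      exact annularRamp_eq_zero_of_outer_le hk.le hs.le
    rw [if_neg (by push Not; exact ⟨fun _ => by linarith, fun _ => r4.le⟩)]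
    exact (hasDerivAt_const s₀ (0 : ℝ)).congr_of_eventuallyEq hev

/-- The four kink spheres are Lebesgue-null: for a.e. `x`, `‖x − x₀‖` avoids any given radius. [folklore] -/
theorem ae_norm_sub_ne (x₀ : ℝ³) (r : ℝ) : ∀ᵐ x : ℝ³, ‖x - x₀‖ ≠ r := by
  have h : volume (Metric.sphere x₀ r) = 0 := Measure.addHaar_sphere volume x₀ r
  rw [measure_eq_zero_iff_ae_notMem] at h
  filter_upwards [h] with x hx
  rwa [Metric.mem_sphere, dist_eq_norm] at hx

/-- **The recession derivative.** For continuous `g` and the cutoff with radii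
`a + s/c`, `b − s/c` (nondegenerate at `s₀`: the plateau is nonempty),
`d/ds ∫ g η_s = −(k/c) ∫_{layers(s₀)} g` at `s = s₀` (differentiation under the integral sign
with a Lipschitz bound; the kinks lie on four null spheres). With `g = ½|ω(τ)|²` and
`s = σ(t) = ∫₀ᵗ‖u‖_{L^∞}` this is the recession term: `∂ₜ` of `½∫|ω(τ)|²η(t)` equals
`−(k/2c)‖u(t)‖_{L^∞}∫_{layers}|ω(τ)|² = −Y₂`-type, wherever `σ` is differentiable. [cite: Tao2011, §10, proof of Thm. 10.1 (the term Y₂, (10.12))] -/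
theorem hasDerivAt_integral_mul_movingCutoff_param (hk : 0 < k) (hc : 0 < c) {g : ℝ³ → ℝ}
    (hg : Continuous g) {s₀ : ℝ} (hgap : a + s₀ / c + k⁻¹ < b - s₀ / c - k⁻¹) :
    HasDerivAt (fun s => ∫ x, g x * movingCutoff x₀ k (fun s => a + s / c) (fun s => b - s / c) s x)
      (-(k / c) * ∫ x in transitionLayers x₀ k c a b s₀, g x) s₀ := by
  set ρ₁ : ℝ → ℝ := fun s => a + s / c with hρ₁
  set ρ₂ : ℝ → ℝ := fun s => b - s / c with hρ₂
  set L := transitionLayers x₀ k c a b s₀ with hL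
  have hLm : MeasurableSet L := measurableSet_transitionLayers x₀ k c a b s₀
  -- the derivative integrand
  set F' : ℝ³ → ℝ := fun x => -(k / c) * L.indicator g x with hF'
  have hF'int : ∫ x, F' x = -(k / c) * ∫ x in L, g x := by
    simp only [hF']
    rw [MeasureTheory.integral_const_mul, MeasureTheory.integral_indicator hLm]
  rw [← hF'int]
  -- the big ball containing all supports for `s ∈ ball s₀ c`
  set Rbig : ℝ := b - s₀ / c + 1 with hRbig
  have hρ₂le : ∀ s ∈ Metric.ball s₀ c, ρ₂ s ≤ Rbig := by
    intro s hs
    rw [Metric.mem_ball, Real.dist_eq] at hs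
    have : -(s / c) ≤ -(s₀ / c) + 1 := by
      rw [show -(s / c) = -(s₀ / c) + (s₀ - s) / c by ring]
      have h1 : (s₀ - s) / c ≤ |s - s₀| / c := div_le_div_of_nonneg_right
        (by rw [abs_sub_comm]; exact le_abs_self _) hc.le
      have h2 : |s - s₀| / c < 1 := by rw [div_lt_one hc]; exact hs
      linarith
    simp only [hρ₂, hRbig]; linarith
  have hzero : ∀ s ∈ Metric.ball s₀ c, ∀ x ∉ Metric.closedBall x₀ Rbig,
      g x * movingCutoff x₀ k ρ₁ ρ₂ s x = 0 := fun s hs x hx =>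
    mul_movingCutoff_eq_zero_of_notMem (ρ₁ := ρ₁) hk.le (hρ₂le s hs) g hx
  -- hypotheses of the parametric differentiation lemma
  have hslice : ∀ s, Continuous fun x => g x * movingCutoff x₀ k ρ₁ ρ₂ s x := fun s =>
    hg.mul (continuous_movingCutoff_slice hk.le x₀ ρ₁ ρ₂ s)
  have hF_meas : ∀ᶠ s in 𝓝 s₀, AEStronglyMeasurable (fun x => g x * movingCutoff x₀ k ρ₁ ρ₂ s x) volume :=
    Eventually.of_forall fun s => (hslice s).aestronglyMeasurable
  have hF_int : Integrable (fun x => g x * movingCutoff x₀ k ρ₁ ρ₂ s₀ x) :=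
    (hslice s₀).integrable_of_hasCompactSupport ((hasCompactSupport_movingCutoff hk.le).mul_left)
  have hF'_meas : AEStronglyMeasurable F' volume :=
    ((hg.aestronglyMeasurable.indicator hLm).const_mul _)
  set bound : ℝ³ → ℝ := (Metric.closedBall x₀ Rbig).indicator fun x => k / c * |g x| with hbound
  have hbound_int : Integrable bound := by
    simp only [hbound]
    rw [integrable_indicator_iff Metric.isClosed_closedBall.measurableSet]
    exact ((continuous_const.mul hg.abs).continuousOn).integrableOn_compact
      (isCompact_closedBall x₀ Rbig)
  have h_lipsch : ∀ᵐ x ∂volume, LipschitzOnWith (Real.nnabs (bound x))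
      (fun s => g x * movingCutoff x₀ k ρ₁ ρ₂ s x) (Metric.ball s₀ c) := by
    refine ae_of_all _ fun x => ?_
    refine LipschitzOnWith.of_dist_le_mul fun s hs s' hs' => ?_
    by_cases hx : x ∈ Metric.closedBall x₀ Rbig
    · have hb : (Real.nnabs (bound x) : ℝ) = k / c * |g x| := by
        rw [Real.coe_nnabs, hbound, indicator_of_mem hx, abs_of_nonneg (by positivity)]
      rw [hb, Real.dist_eq, Real.dist_eq, ← mul_sub, abs_mul]
      have h := abs_movingCutoff_speedRadii_sub_le (x₀ := x₀) hk.le (R₁' := a) (R₂' := b) hc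
        (fun τ => τ) s' s x
      calc |g x| * |movingCutoff x₀ k ρ₁ ρ₂ s x - movingCutoff x₀ k ρ₁ ρ₂ s' x|
          ≤ |g x| * (k * (|s - s'| / c)) := mul_le_mul_of_nonneg_left h (abs_nonneg _)
        _ = k / c * |g x| * |s - s'| := by ring
    · rw [hzero s hs x hx, hzero s' hs' x hx, dist_self]
      positivity
  have h_diff : ∀ᵐ x ∂volume, HasDerivAt (fun s => g x * movingCutoff x₀ k ρ₁ ρ₂ s x) (F' x) s₀ := by
    filter_upwards [ae_norm_sub_ne x₀ (a + s₀ / c), ae_norm_sub_ne x₀ (a + s₀ / c + k⁻¹),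
      ae_norm_sub_ne x₀ (b - s₀ / c - k⁻¹), ae_norm_sub_ne x₀ (b - s₀ / c)] with x h1 h2 h3 h4
    have hd := (hasDerivAt_annularRamp_param hk hgap h1 h2 h3 h4).const_mul (g x)
    refine hd.congr_deriv ?_
    simp only [hF', hL, transitionLayers, indicator, mem_union, mem_setOf_eq]
    split_ifs <;> ring
  exact (hasDerivAt_integral_of_dominated_loc_of_lip (Metric.ball_mem_nhds s₀ hc) hF_meas hF_int
    hF'_meas h_lipsch hbound_int h_diff).2

end Recession

/-! ## The production derivative: differentiating `τ ↦ ½∫|ω(τ)|²φ` for a frozen cutoff -/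

section Production

variable {T : ℝ} {w : ℝ → ℝ³ → ℝ³}

/-- **`∂ₜω = curl ∂ₜu` at interior times**: the time line of the vorticity of a jointly smooth
field has derivative `curl (∂ₜw(t, ·))(x)` at every `t ∈ (0, T)`. [folklore] -/
theorem hasDerivAt_curl_slice (hw : FluidPDE.IsSmoothSpaceTimeOn (Icc 0 T) w) {t : ℝ}
    (ht : t ∈ Ioo 0 T) (x : ℝ³) :
    HasDerivAt (fun s => FluidPDE.curl (w s) x)
      (FluidPDE.curl (FluidPDE.timeDerivWithin (Icc 0 T) w t) x) t := by
  have h := (hw.mono Ioo_subset_Icc_self).hasDerivAt_fderiv_slice_clm isOpen_Ioo ht x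
  have h2 := FluidPDE.curlCLM.hasFDerivAt.comp_hasDerivAt t h
  rw [FluidPDE.timeDerivWithin_eq_deriv_of_isOpen_subset isOpen_Ioo Ioo_subset_Icc_self ht w]
  exact h2

/-- The **enstrophy production density** `⟨ω, ∂ₜω⟩(t, x)` of a jointly smooth field on the
slab `[0, T] × ℝ³` (`∂ₜ` the one-sided slab derivative, equal to the two-sided one at interior
times). [cite: Tao2011, §10, proof of Thm. 10.1 (∂ₜ½|ω|², the enstrophy equation)] -/
def enstrophyProduction (T : ℝ) (w : ℝ → ℝ³ → ℝ³) (t : ℝ) (x : ℝ³) : ℝ :=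
  inner ℝ (FluidPDE.curl (w t) x) (FluidPDE.curl (FluidPDE.timeDerivWithin (Icc 0 T) w t) x)

/-- Unfolding `enstrophyProduction`. [folklore] -/
theorem enstrophyProduction_apply (T : ℝ) (w : ℝ → ℝ³ → ℝ³) (t : ℝ) (x : ℝ³) :
    enstrophyProduction T w t x =
      inner ℝ (FluidPDE.curl (w t) x) (FluidPDE.curl (FluidPDE.timeDerivWithin (Icc 0 T) w t) x) := rfl

/-- `d/dt ½|ω(t, x)|² = ⟨ω, ∂ₜω⟩(t, x)` at interior times. [cite: Tao2011, §10, proof of Thm. 10.1 (the enstrophy equation)] -/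
theorem hasDerivAt_half_norm_curl_sq (hw : FluidPDE.IsSmoothSpaceTimeOn (Icc 0 T) w) {t : ℝ}
    (ht : t ∈ Ioo 0 T) (x : ℝ³) :
    HasDerivAt (fun s => 1 / 2 * ‖FluidPDE.curl (w s) x‖ ^ 2) (enstrophyProduction T w t x) t := by
  have h := ((hasDerivAt_curl_slice hw ht x).norm_sq).const_mul (1 / 2 : ℝ)
  refine (h.congr_of_eventuallyEq (Eventually.of_forall fun s => rfl)).congr_deriv ?_
  rw [enstrophyProduction_apply]
  ring

/-- The production density is jointly continuous on the closed slab. [folklore] -/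
theorem continuousOn_enstrophyProduction (hT : 0 < T) (hw : FluidPDE.IsSmoothSpaceTimeOn (Icc 0 T) w) :
    ContinuousOn (uncurry (enstrophyProduction T w)) (Icc 0 T ×ˢ univ) :=
  (continuousOn_curl_slab hT hw).inner
    (continuousOn_curl_slab hT (hw.timeDerivWithin (uniqueDiffOn_Icc hT)))

/-- **Differentiating the frozen-cutoff enstrophy.** For a continuous weight `φ` supported in a
compact set and an interior time `t₀ ∈ (0, T)`,
`d/dt ½∫|ω(t)|²φ |_{t₀} = ∫ ⟨ω, ∂ₜω⟩(t₀) φ` (differentiation under the integral sign, dominated on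
a compact time-neighbourhood by the maximum of the continuous `⟨ω, ∂ₜω⟩φ`). This is the first
partial derivative `∂₁Ψ` in the diagonal chain rule for `W(t) = Ψ(t, t)`,
`Ψ(τ₁, τ₂) = ½∫|ω(τ₁)|²η(τ₂)`. [cite: Tao2011, §10, proof of Thm. 10.1 ("we will compute the derivative ∂ₜW")] -/
theorem hasDerivAt_localisedEnstrophy_frozen (hT : 0 < T) (hw : FluidPDE.IsSmoothSpaceTimeOn (Icc 0 T) w)
    {φ : ℝ³ → ℝ} (hφ : Continuous φ) {K : Set ℝ³} (hK : IsCompact K) (hsupp : ∀ x ∉ K, φ x = 0)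
    {t₀ : ℝ} (ht₀ : t₀ ∈ Ioo 0 T) :
    HasDerivAt (fun t => localisedEnstrophy φ (w t)) (∫ x, enstrophyProduction T w t₀ x * φ x) t₀ := by
  have ht₀0 : 0 < t₀ := ht₀.1
  have ht₀T : t₀ < T := ht₀.2
  -- a compact time-neighbourhood `J = [t₀ - ε, t₀ + ε] ⊆ (0, T)`
  obtain ⟨ε, hε, hεle₁, hεle₂⟩ : ∃ ε : ℝ, 0 < ε ∧ ε < t₀ ∧ ε < T - t₀ :=
    ⟨min t₀ (T - t₀) / 2, by positivity,
      by linarith [min_le_left t₀ (T - t₀)], by linarith [min_le_right t₀ (T - t₀)]⟩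
  have hJ : Icc (t₀ - ε) (t₀ + ε) ⊆ Ioo 0 T :=
    Icc_subset_Ioo (sub_pos.2 hεle₁) (lt_sub_iff_add_lt'.1 hεle₂)
  have hJn : Icc (t₀ - ε) (t₀ + ε) ∈ 𝓝 t₀ :=
    Icc_mem_nhds (sub_lt_self t₀ hε) (lt_add_of_pos_right t₀ hε)
  have hJI : Icc (t₀ - ε) (t₀ + ε) ⊆ Icc 0 T := hJ.trans Ioo_subset_Icc_self
  -- the integrand `F t x = ½|ω(t,x)|²φ(x)` and its time derivative `F' t x = ⟨ω,∂ₜω⟩(t,x)φ(x)`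
  have hA : ContinuousOn (fun z : ℝ × ℝ³ => ‖FluidPDE.curl (w z.1) z.2‖ ^ 2) (Icc 0 T ×ˢ univ) :=
    (continuousOn_curl_slab hT hw).norm.pow 2
  have hP : ContinuousOn (fun z : ℝ × ℝ³ => enstrophyProduction T w z.1 z.2) (Icc 0 T ×ˢ univ) :=
    continuousOn_enstrophyProduction hT hw
  have hφ2 : ContinuousOn (fun z : ℝ × ℝ³ => φ z.2) (Icc 0 T ×ˢ univ) :=
    (hφ.comp continuous_snd).continuousOn
  have hhalf : ContinuousOn (fun _ : ℝ × ℝ³ => (1 / 2 : ℝ)) (Icc 0 T ×ˢ univ) := continuousOn_const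
  have hFc : ContinuousOn (fun z : ℝ × ℝ³ => 1 / 2 * ‖FluidPDE.curl (w z.1) z.2‖ ^ 2 * φ z.2)
      (Icc 0 T ×ˢ univ) := (hhalf.mul hA).mul hφ2
  have hF'c : ContinuousOn (fun z : ℝ × ℝ³ => enstrophyProduction T w z.1 z.2 * φ z.2)
      (Icc 0 T ×ˢ univ) := hP.mul hφ2
  have hU : UniqueDiffOn ℝ (Icc 0 T) := uniqueDiffOn_Icc hT
  have hcurlc : ∀ t ∈ Icc 0 T, Continuous (FluidPDE.curl (w t)) := fun t ht =>
    FluidPDE.continuous_curl ((hw.contDiff_slice ht).of_le (by norm_cast))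
  have hcurlc' : ∀ t ∈ Icc 0 T, Continuous (FluidPDE.curl (FluidPDE.timeDerivWithin (Icc 0 T) w t)) :=
    fun t ht => FluidPDE.continuous_curl (((hw.timeDerivWithin hU).contDiff_slice ht).of_le (by norm_cast))
  have hslice : ∀ t ∈ Icc 0 T, Continuous fun x => 1 / 2 * ‖FluidPDE.curl (w t) x‖ ^ 2 * φ x :=
    fun t ht => (continuous_const.mul ((hcurlc t ht).norm.pow 2)).mul hφ
  have hslice' : ∀ t ∈ Icc 0 T, Continuous fun x => enstrophyProduction T w t x * φ x :=
    fun t ht => ((hcurlc t ht).inner (hcurlc' t ht)).mul hφ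
  -- uniform bound for `F'` on `J × K`
  obtain ⟨C, hC⟩ : ∃ C, ∀ z ∈ Icc (t₀ - ε) (t₀ + ε) ×ˢ K,
      ‖enstrophyProduction T w z.1 z.2 * φ z.2‖ ≤ C :=
    (isCompact_Icc.prod hK).exists_bound_of_continuousOn (hF'c.mono (prod_mono hJI (subset_univ _)))
  -- hypotheses of the differentiation lemma
  have hF_meas : ∀ᶠ t in 𝓝 t₀, AEStronglyMeasurable
      (fun x => 1 / 2 * ‖FluidPDE.curl (w t) x‖ ^ 2 * φ x) volume :=
    (Filter.eventually_of_mem (Ioo_mem_nhds ht₀0 ht₀T)) fun t ht =>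
      (hslice t (Ioo_subset_Icc_self ht)).aestronglyMeasurable
  have hF_int : Integrable (fun x => 1 / 2 * ‖FluidPDE.curl (w t₀) x‖ ^ 2 * φ x) := by
    refine (hslice t₀ (Ioo_subset_Icc_self ht₀)).integrable_of_hasCompactSupport ?_
    refine HasCompactSupport.of_support_subset_isCompact hK fun x hx => by_contra fun h => hx ?_
    simp only [hsupp x h, mul_zero]
  have hF'_meas : AEStronglyMeasurable (fun x => enstrophyProduction T w t₀ x * φ x) volume :=
    (hslice' t₀ (Ioo_subset_Icc_self ht₀)).aestronglyMeasurable
  have h_bound : ∀ᵐ x ∂(volume : Measure ℝ³), ∀ t ∈ Icc (t₀ - ε) (t₀ + ε),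
      ‖enstrophyProduction T w t x * φ x‖ ≤ K.indicator (fun _ => max C 0) x := by
    refine ae_of_all _ fun x t ht => ?_
    by_cases hx : x ∈ K
    · rw [indicator_of_mem hx]
      exact (hC (t, x) (mk_mem_prod ht hx)).trans (le_max_left _ _)
    · rw [indicator_of_notMem hx, hsupp x hx, mul_zero, norm_zero]
  have hbound_int : Integrable (K.indicator fun _ : ℝ³ => max C 0) := by
    rw [integrable_indicator_iff hK.measurableSet]
    exact integrableOn_const hK.measure_lt_top.ne
  have h_diff : ∀ᵐ x ∂(volume : Measure ℝ³), ∀ t ∈ Icc (t₀ - ε) (t₀ + ε),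
      HasDerivAt (fun t => 1 / 2 * ‖FluidPDE.curl (w t) x‖ ^ 2 * φ x)
        (enstrophyProduction T w t x * φ x) t :=
    ae_of_all _ fun x t ht => (hasDerivAt_half_norm_curl_sq hw (hJ ht) x).mul_const (φ x)
  have key := (hasDerivAt_integral_of_dominated_loc_of_deriv_le hJn hF_meas hF_int hF'_meas
    h_bound hbound_int h_diff).2
  -- `localisedEnstrophy φ (w t) = ∫ F t`
  have heq : (fun t => localisedEnstrophy φ (w t)) =
      fun t => ∫ x, 1 / 2 * ‖FluidPDE.curl (w t) x‖ ^ 2 * φ x := by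
    funext t
    rw [localisedEnstrophy_def, ← MeasureTheory.integral_const_mul]
    simp only [mul_assoc]
  rw [heq]
  exact key

/-- **Joint continuity of the production against the moving cutoff**:
`(τ₁, τ₂) ↦ ∫ ⟨ω, ∂ₜω⟩(τ₁) η(τ₂)` is continuous on `[0, T]²` for continuous radii with bounded
outer radius (the hypothesis of the diagonal chain rule). [folklore] -/
theorem continuousOn_integral_enstrophyProduction_movingCutoff (hT : 0 < T)
    (hw : FluidPDE.IsSmoothSpaceTimeOn (Icc 0 T) w) {x₀ : ℝ³} {k : ℝ} (hk : 0 ≤ k) {ρ₁ ρ₂ : ℝ → ℝ}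
    (h₁ : ContinuousOn ρ₁ (Icc 0 T)) (h₂ : ContinuousOn ρ₂ (Icc 0 T)) {R : ℝ}
    (hR : ∀ t ∈ Icc 0 T, ρ₂ t ≤ R) :
    ContinuousOn (fun q : ℝ × ℝ => ∫ x, enstrophyProduction T w q.1 x * movingCutoff x₀ k ρ₁ ρ₂ q.2 x)
      (Icc 0 T ×ˢ Icc 0 T) := by
  have hP := continuousOn_enstrophyProduction hT hw
  have hη := continuousOn_movingCutoff_uncurry (x₀ := x₀) k h₁ h₂
  -- joint continuity of `((τ₁, τ₂), x) ↦ P τ₁ x * η τ₂ x`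
  have hf : ContinuousOn (uncurry fun q : ℝ × ℝ => fun x : ℝ³ =>
      enstrophyProduction T w q.1 x * movingCutoff x₀ k ρ₁ ρ₂ q.2 x)
      ((Icc 0 T ×ˢ Icc 0 T) ×ˢ univ) := by
    have hA : ContinuousOn (fun z : (ℝ × ℝ) × ℝ³ => uncurry (enstrophyProduction T w) (z.1.1, z.2))
        ((Icc 0 T ×ˢ Icc 0 T) ×ˢ univ) :=
      hP.comp (by fun_prop) fun z hz => mk_mem_prod hz.1.1 (mem_univ _)
    have hB : ContinuousOn (fun z : (ℝ × ℝ) × ℝ³ => uncurry (movingCutoff x₀ k ρ₁ ρ₂) (z.1.2, z.2))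
        ((Icc 0 T ×ˢ Icc 0 T) ×ˢ univ) :=
      hη.comp (by fun_prop) fun z hz => mk_mem_prod hz.1.2 (mem_univ _)
    exact hA.mul hB
  refine continuousOn_integral_of_compact_support (isCompact_closedBall x₀ R) hf ?_
  rintro ⟨τ₁, τ₂⟩ x ⟨-, h2τ⟩ hx
  exact mul_movingCutoff_eq_zero_of_notMem (ρ₁ := ρ₁) hk (hR τ₂ h2τ) _ hx

end Production

/-! ## The time derivative of `W(t)` along the speed-driven cutoff -/

section Derivative

variable {T : ℝ} {x₀ : ℝ³} {k c R₁' R₂' : ℝ}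

/-- **The derivative of the localised enstrophy along the moving cutoff** (a.e. in time). Let
`η(t, x) = annularRamp k (R₁' + σ(t)/c) (R₂' − σ(t)/c) ‖x − x₀‖` with `σ ≥ 0` continuous on
`[0, T]` (in §10, `σ(t) = ∫₀ᵗ‖u‖_{L^∞}`), and let `τ ∈ (0, T)` be a time at which `σ` is
differentiable (a.e. `τ`, `TaoSpeedIntegral.ae_hasDerivAt_speedIntegral`) and the plateau is
nonempty. Then `W(t) = ½∫|ω(t)|²η(t)` is differentiable at `τ` with
`W'(τ) = ∫⟨ω, ∂ₜω⟩(τ) η(τ) − (k/c) σ'(τ) · ½∫_{layers(τ)} |ω(τ)|²`: the production against the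
frozen cutoff (to be integrated by parts in `x` into `−Y₁ + Y₃ + Y₄ + Y₆` via the vorticity
equation) plus the **recession term** `−Y₂ = ½∫|ω|²∂ₜη ≤ 0` of (10.11). Proof: diagonal chain
rule (`hasDerivAt_diagonal`) with `∂₁` from `hasDerivAt_localisedEnstrophy_frozen` and `∂₂` from
`hasDerivAt_integral_mul_movingCutoff_param` composed with `σ`. [cite: Tao2011, §10, proof of Thm. 10.1 ((10.11), terms Y₂ and ∂ₜW)] -/
theorem hasDerivAt_localisedEnstrophy_movingCutoff (hT : 0 < T) {u : ℝ → ℝ³ → ℝ³}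
    (hw : FluidPDE.IsSmoothSpaceTimeOn (Icc 0 T) u) (hk : 0 < k) (hc : 0 < c)
    {σ : ℝ → ℝ} (hσc : ContinuousOn σ (Icc 0 T)) (hσ0 : ∀ t ∈ Icc 0 T, 0 ≤ σ t)
    {τ : ℝ} (hτ : τ ∈ Ioo 0 T) {σ' : ℝ} (hστ : HasDerivAt σ σ' τ)
    (hgap : R₁' + σ τ / c + k⁻¹ < R₂' - σ τ / c - k⁻¹) :
    HasDerivAt (fun t => localisedEnstrophy
        (movingCutoff x₀ k (fun t => R₁' + σ t / c) (fun t => R₂' - σ t / c) t) (u t))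
      ((∫ x, enstrophyProduction T u τ x *
          movingCutoff x₀ k (fun t => R₁' + σ t / c) (fun t => R₂' - σ t / c) τ x) -
        k / c * σ' * (1 / 2 * ∫ x in transitionLayers x₀ k c R₁' R₂' (σ τ),
          ‖FluidPDE.curl (u τ) x‖ ^ 2)) τ := by
  have hρ₁ : ContinuousOn (fun t => R₁' + σ t / c) (Icc 0 T) :=
    continuousOn_const.add (hσc.div_const c)
  have hρ₂ : ContinuousOn (fun t => R₂' - σ t / c) (Icc 0 T) :=
    continuousOn_const.sub (hσc.div_const c)
  have hR : ∀ t ∈ Icc 0 T, R₂' - σ t / c ≤ R₂' := fun t ht => by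
    have := div_nonneg (hσ0 t ht) hc.le
    linarith
  have hnhds : Ioo 0 T ×ˢ Ioo 0 T ∈ 𝓝 ((τ, τ) : ℝ × ℝ) :=
    prod_mem_nhds (Ioo_mem_nhds hτ.1 hτ.2) (Ioo_mem_nhds hτ.1 hτ.2)
  -- the diagonal chain rule
  refine (hasDerivAt_diagonal
    (Ψ := fun τ₁ τ₂ => localisedEnstrophy
      (movingCutoff x₀ k (fun t => R₁' + σ t / c) (fun t => R₂' - σ t / c) τ₂) (u τ₁))
    (Ψ₁ := fun τ₁ τ₂ => ∫ x, enstrophyProduction T u τ₁ x *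
      movingCutoff x₀ k (fun t => R₁' + σ t / c) (fun t => R₂' - σ t / c) τ₂ x)
    (D₂ := 1 / 2 * (-(k / c) * ∫ x in transitionLayers x₀ k c R₁' R₂' (σ τ),
      ‖FluidPDE.curl (u τ) x‖ ^ 2) * σ') ?_ ?_ ?_).congr_deriv (by ring)
  · -- `∂₁`: the frozen-cutoff derivative, at every point of `(0,T)²`
    refine Filter.mem_of_superset hnhds ?_
    rintro ⟨τ₁, τ₂⟩ ⟨h₁, h₂⟩
    exact hasDerivAt_localisedEnstrophy_frozen hT hw
      (continuous_movingCutoff_slice hk.le x₀ _ _ τ₂) (isCompact_closedBall x₀ R₂')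
      (fun x hx => by
        have h := mul_movingCutoff_eq_zero_of_notMem (ρ₁ := fun t => R₁' + σ t / c)
          (ρ₂ := fun t => R₂' - σ t / c) hk.le (hR τ₂ (Ioo_subset_Icc_self h₂)) (fun _ => (1 : ℝ)) hx
        rwa [one_mul] at h) h₁
  · -- joint continuity of `∂₁Ψ` at `(τ, τ)`
    have hcont := continuousOn_integral_enstrophyProduction_movingCutoff (x₀ := x₀) hT hw hk.le
      hρ₁ hρ₂ hR
    exact hcont.continuousAt (prod_mem_nhds (Icc_mem_nhds hτ.1 hτ.2) (Icc_mem_nhds hτ.1 hτ.2))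
  · -- `∂₂`: the recession derivative composed with `σ`
    have hg : Continuous fun x => ‖FluidPDE.curl (u τ) x‖ ^ 2 :=
      (FluidPDE.continuous_curl ((hw.contDiff_slice (Ioo_subset_Icc_self hτ)).of_le
        (by norm_cast))).norm.pow 2
    have hG := hasDerivAt_integral_mul_movingCutoff_param (x₀ := x₀) (a := R₁') (b := R₂') hk hc
      hg hgap
    have hcomp := (hG.const_mul (1 / 2 : ℝ)).comp τ hστ
    exact hcomp

end Derivative

/-! ## Absolute continuity of `W(t)` and the integrated identity `W(t) − W(s) = ∫ₛᵗ W'` -/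

section AbsCont

variable {T : ℝ} {w : ℝ → ℝ³ → ℝ³} {x₀ : ℝ³} {k c R₁' R₂' : ℝ}

/-- **Lipschitz in time of the vorticity on compacts**: for a jointly smooth field on the closed
slab and a compact `K`, `|curl w(t)(x) − curl w(s)(x)| ≤ C|t − s|` uniformly in `x ∈ K` (the
slice derivatives form a jointly smooth field, whose one-sided time derivative is continuous,
hence bounded on `[0, T] × K`; mean value inequality). [folklore] -/
theorem exists_lipschitz_curl_slab (hT : 0 < T) (hw : FluidPDE.IsSmoothSpaceTimeOn (Icc 0 T) w)
    {K : Set ℝ³} (hK : IsCompact K) :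
    ∃ C : ℝ, 0 ≤ C ∧ ∀ s ∈ Icc 0 T, ∀ t ∈ Icc 0 T, ∀ x ∈ K,
      ‖FluidPDE.curl (w t) x - FluidPDE.curl (w s) x‖ ≤ C * |t - s| := by
  have hU : UniqueDiffOn ℝ (Icc 0 T) := uniqueDiffOn_Icc hT
  have hD : FluidPDE.IsSmoothSpaceTimeOn (Icc 0 T) (fun t x => fderiv ℝ (w t) x) := hw.fderiv_slice hU
  have hDt : FluidPDE.IsSmoothSpaceTimeOn (Icc 0 T)
      (FluidPDE.timeDerivWithin (Icc 0 T) fun t x => fderiv ℝ (w t) x) := hD.timeDerivWithin hU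
  obtain ⟨B, hB⟩ := hDt.exists_bound isCompact_Icc hK
  have hB0 : 0 ≤ max B 0 := le_max_right _ _
  refine ⟨‖FluidPDE.curlCLM‖ * max B 0, by positivity, fun s hs t ht x hx => ?_⟩
  -- Lipschitz bound for `t ↦ D(w t)(x)` on the convex set `[0, T]`
  have hlip : LipschitzOnWith (Real.toNNReal (max B 0)) (fun t => fderiv ℝ (w t) x) (Icc 0 T) := by
    refine (convex_Icc 0 T).lipschitzOnWith_of_nnnorm_hasDerivWithin_le
      (fun τ hτ => hD.hasDerivWithinAt_timeDerivWithin hU hτ x) fun τ hτ => ?_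
    rw [← NNReal.coe_le_coe, coe_nnnorm, Real.coe_toNNReal _ hB0]
    exact (hB τ hτ x hx).trans (le_max_left _ _)
  have h1 : ‖fderiv ℝ (w t) x - fderiv ℝ (w s) x‖ ≤ max B 0 * |t - s| := by
    have := hlip.norm_sub_le ht hs
    rwa [Real.coe_toNNReal _ hB0, Real.norm_eq_abs] at this
  calc ‖FluidPDE.curl (w t) x - FluidPDE.curl (w s) x‖
      = ‖FluidPDE.curlCLM (fderiv ℝ (w t) x - fderiv ℝ (w s) x)‖ := by
        rw [map_sub, FluidPDE.curl_eq_curlCLM, FluidPDE.curl_eq_curlCLM]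
    _ ≤ ‖FluidPDE.curlCLM‖ * ‖fderiv ℝ (w t) x - fderiv ℝ (w s) x‖ := FluidPDE.curlCLM.le_opNorm _
    _ ≤ ‖FluidPDE.curlCLM‖ * (max B 0 * |t - s|) :=
        mul_le_mul_of_nonneg_left h1 (norm_nonneg FluidPDE.curlCLM)
    _ = ‖FluidPDE.curlCLM‖ * max B 0 * |t - s| := by ring

/-- A weighted integral bound used twice below: if `|F x| ≤ M` on a compact measurable `K` and
`F` vanishes off `K`, then `|∫ F| ≤ M · vol(K)`. [folklore] -/
theorem abs_integral_le_of_bound_of_support {F : ℝ³ → ℝ} {K : Set ℝ³} (hK : IsCompact K)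
    {M : ℝ} (hM : ∀ x ∈ K, |F x| ≤ M) (hzero : ∀ x ∉ K, F x = 0) :
    |∫ x, F x| ≤ M * (volume K).toReal := by
  have hKm : MeasurableSet K := hK.measurableSet
  have hg : Integrable (K.indicator fun _ : ℝ³ => M) := by
    rw [integrable_indicator_iff hKm]
    exact integrableOn_const hK.measure_lt_top.ne
  have hle : ∀ x, ‖F x‖ ≤ K.indicator (fun _ => M) x := fun x => by
    by_cases hx : x ∈ K
    · rw [indicator_of_mem hx, Real.norm_eq_abs]; exact hM x hx
    · rw [indicator_of_notMem hx, hzero x hx, norm_zero]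
  have h := norm_integral_le_of_norm_le hg (ae_of_all _ hle)
  rw [integral_indicator_const M hKm, smul_eq_mul, Real.norm_eq_abs] at h
  rwa [mul_comm] at h

/-- **Lipschitz in time of the frozen-cutoff enstrophy**, uniformly over weights `φ ∈ [0, 1]`
vanishing off a fixed compact `K`. [folklore] -/
theorem exists_lipschitz_localisedEnstrophy_time (hT : 0 < T)
    (hw : FluidPDE.IsSmoothSpaceTimeOn (Icc 0 T) w) {K : Set ℝ³} (hK : IsCompact K) :
    ∃ L : ℝ, 0 ≤ L ∧ ∀ (φ : ℝ³ → ℝ), Continuous φ → (∀ x, 0 ≤ φ x) → (∀ x, φ x ≤ 1) →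
      (∀ x ∉ K, φ x = 0) → ∀ s ∈ Icc 0 T, ∀ t ∈ Icc 0 T,
        |localisedEnstrophy φ (w t) - localisedEnstrophy φ (w s)| ≤ L * |t - s| := by
  obtain ⟨C, hC0, hC⟩ := exists_lipschitz_curl_slab hT hw hK
  obtain ⟨B, hB⟩ := (IsSmoothSpaceTimeOn.exists_bound (w := fun t x => FluidPDE.curl (w t) x)
    (by exact (hw.fderiv_slice (uniqueDiffOn_Icc hT)).clm FluidPDE.curlCLM) isCompact_Icc hK)
  have hB0 : 0 ≤ max B 0 := le_max_right _ _
  refine ⟨1 / 2 * (2 * max B 0 * C) * (volume K).toReal, by positivity, ?_⟩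
  intro φ hφc hφ0 hφ1 hφK s hs t ht
  have hpt : ∀ x ∈ K, |(‖FluidPDE.curl (w t) x‖ ^ 2 - ‖FluidPDE.curl (w s) x‖ ^ 2) * φ x| ≤
      2 * max B 0 * C * |t - s| := by
    intro x hx
    have hbt : ‖FluidPDE.curl (w t) x‖ ≤ max B 0 := (hB t ht x hx).trans (le_max_left _ _)
    have hbs : ‖FluidPDE.curl (w s) x‖ ≤ max B 0 := (hB s hs x hx).trans (le_max_left _ _)
    have hd : |‖FluidPDE.curl (w t) x‖ - ‖FluidPDE.curl (w s) x‖| ≤ C * |t - s| :=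
      (abs_norm_sub_norm_le _ _).trans (hC s hs t ht x hx)
    rw [abs_mul, abs_of_nonneg (hφ0 x), sq_sub_sq, abs_mul]
    have h1 : |‖FluidPDE.curl (w t) x‖ + ‖FluidPDE.curl (w s) x‖| ≤ 2 * max B 0 := by
      rw [abs_of_nonneg (by positivity)]; linarith
    calc |‖FluidPDE.curl (w t) x‖ + ‖FluidPDE.curl (w s) x‖| * |‖FluidPDE.curl (w t) x‖ - ‖FluidPDE.curl (w s) x‖| * φ x
        ≤ 2 * max B 0 * (C * |t - s|) * 1 := by
          refine mul_le_mul (mul_le_mul h1 hd (abs_nonneg _) (by positivity)) (hφ1 x)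
            (hφ0 x) (by positivity)
      _ = 2 * max B 0 * C * |t - s| := by ring
  have hz : ∀ x ∉ K, (‖FluidPDE.curl (w t) x‖ ^ 2 - ‖FluidPDE.curl (w s) x‖ ^ 2) * φ x = 0 :=
    fun x hx => by rw [hφK x hx, mul_zero]
  have hint := abs_integral_le_of_bound_of_support hK hpt hz
  -- `W(t) − W(s) = ½∫(|ω t|² − |ω s|²)φ` (both integrands integrable or the bound is trivial)
  have hti : ∀ τ ∈ Icc 0 T, Integrable fun x => ‖FluidPDE.curl (w τ) x‖ ^ 2 * φ x := by
    intro τ hτ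
    have hcont : Continuous fun x => ‖FluidPDE.curl (w τ) x‖ ^ 2 * φ x :=
      ((FluidPDE.continuous_curl ((hw.contDiff_slice hτ).of_le (by norm_cast))).norm.pow 2).mul hφc
    refine hcont.integrable_of_hasCompactSupport
      (HasCompactSupport.of_support_subset_isCompact hK fun x hx => by_contra fun h => hx ?_)
    simp only [hφK x h, mul_zero]
  rw [localisedEnstrophy_def, localisedEnstrophy_def, ← mul_sub, ← integral_sub (hti t ht) (hti s hs),
    abs_mul, abs_of_nonneg (by norm_num : (0 : ℝ) ≤ 1 / 2)]
  simp_rw [← sub_mul]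
  calc 1 / 2 * |∫ x, (‖FluidPDE.curl (w t) x‖ ^ 2 - ‖FluidPDE.curl (w s) x‖ ^ 2) * φ x|
      ≤ 1 / 2 * (2 * max B 0 * C * |t - s| * (volume K).toReal) :=
        mul_le_mul_of_nonneg_left hint (by norm_num)
    _ = 1 / 2 * (2 * max B 0 * C) * (volume K).toReal * |t - s| := by ring

/-- **Lipschitz in the radius parameter of the localised enstrophy**: for `s, s' ≥ 0` (so that
both cutoffs are supported in `B̄(x₀, R₂')`),
`|W_{η_s}(v) − W_{η_{s'}}(v)| ≤ ½ B² vol(B̄) (k/c)|s − s'|` whenever `‖curl v‖ ≤ B` on `B̄(x₀,R₂')`. [folklore] -/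
theorem abs_localisedEnstrophy_param_sub_le (hk : 0 ≤ k) (hc : 0 < c) {v : ℝ³ → ℝ³} {B : ℝ}
    (hB : ∀ x ∈ Metric.closedBall x₀ R₂', ‖FluidPDE.curl v x‖ ≤ B) {s s' : ℝ}
    (hs : 0 ≤ s) (hs' : 0 ≤ s') (hint : ∀ r, 0 ≤ r → Integrable fun x => ‖FluidPDE.curl v x‖ ^ 2 *
      movingCutoff x₀ k (fun r => R₁' + r / c) (fun r => R₂' - r / c) r x) :
    |localisedEnstrophy (movingCutoff x₀ k (fun r => R₁' + r / c) (fun r => R₂' - r / c) s) v -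
        localisedEnstrophy (movingCutoff x₀ k (fun r => R₁' + r / c) (fun r => R₂' - r / c) s') v| ≤
      1 / 2 * (B ^ 2 * (k / c)) * (volume (Metric.closedBall x₀ R₂')).toReal * |s - s'| := by
  have hK : IsCompact (Metric.closedBall x₀ R₂') := isCompact_closedBall x₀ R₂'
  have hR : ∀ r : ℝ, 0 ≤ r → R₂' - r / c ≤ R₂' := fun r hr => by
    have := div_nonneg hr hc.le; linarith
  have hpt : ∀ x ∈ Metric.closedBall x₀ R₂',
      |‖FluidPDE.curl v x‖ ^ 2 * (movingCutoff x₀ k (fun r => R₁' + r / c) (fun r => R₂' - r / c) s x -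
        movingCutoff x₀ k (fun r => R₁' + r / c) (fun r => R₂' - r / c) s' x)| ≤
        B ^ 2 * (k / c) * |s - s'| := by
    intro x hx
    have h1 : ‖FluidPDE.curl v x‖ ^ 2 ≤ B ^ 2 := pow_le_pow_left₀ (norm_nonneg _) (hB x hx) 2
    have h2 := abs_movingCutoff_speedRadii_sub_le (x₀ := x₀) hk (R₁' := R₁') (R₂' := R₂') hc
      (fun r => r) s' s x
    rw [abs_mul, abs_of_nonneg (sq_nonneg _)]
    calc ‖FluidPDE.curl v x‖ ^ 2 * |movingCutoff x₀ k (fun r => R₁' + r / c) (fun r => R₂' - r / c) s x -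
          movingCutoff x₀ k (fun r => R₁' + r / c) (fun r => R₂' - r / c) s' x|
        ≤ B ^ 2 * (k * (|s - s'| / c)) := mul_le_mul h1 h2 (abs_nonneg _) (sq_nonneg _)
      _ = B ^ 2 * (k / c) * |s - s'| := by ring
  have hz : ∀ x ∉ Metric.closedBall x₀ R₂',
      ‖FluidPDE.curl v x‖ ^ 2 * (movingCutoff x₀ k (fun r => R₁' + r / c) (fun r => R₂' - r / c) s x -
        movingCutoff x₀ k (fun r => R₁' + r / c) (fun r => R₂' - r / c) s' x) = 0 := by
    intro x hx
    rw [mul_sub, mul_movingCutoff_eq_zero_of_notMem (ρ₁ := fun r => R₁' + r / c)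
        (ρ₂ := fun r => R₂' - r / c) (t := s) hk (hR s hs) (fun y => ‖FluidPDE.curl v y‖ ^ 2) hx,
      mul_movingCutoff_eq_zero_of_notMem (ρ₁ := fun r => R₁' + r / c)
        (ρ₂ := fun r => R₂' - r / c) (t := s') hk (hR s' hs') (fun y => ‖FluidPDE.curl v y‖ ^ 2) hx,
      sub_zero]
  have h := abs_integral_le_of_bound_of_support hK hpt hz
  rw [localisedEnstrophy_def, localisedEnstrophy_def, ← mul_sub, ← integral_sub (hint s hs) (hint s' hs'),
    abs_mul, abs_of_nonneg (by norm_num : (0 : ℝ) ≤ 1 / 2)]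
  simp_rw [← mul_sub]
  calc 1 / 2 * |∫ x, ‖FluidPDE.curl v x‖ ^ 2 *
        (movingCutoff x₀ k (fun r => R₁' + r / c) (fun r => R₂' - r / c) s x -
          movingCutoff x₀ k (fun r => R₁' + r / c) (fun r => R₂' - r / c) s' x)|
      ≤ 1 / 2 * (B ^ 2 * (k / c) * |s - s'| * (volume (Metric.closedBall x₀ R₂')).toReal) :=
        mul_le_mul_of_nonneg_left h (by norm_num)
    _ = 1 / 2 * (B ^ 2 * (k / c)) * (volume (Metric.closedBall x₀ R₂')).toReal * |s - s'| := by ring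

/-- **Absolute continuity of the localised enstrophy along the speed-driven cutoff.** If `σ` is
absolutely continuous on `[0, T]` with `0 ≤ σ ≤ M` (the speed integral,
`TaoSpeedIntegral.absolutelyContinuousOnInterval_speedIntegral`), then
`t ↦ W(t) = ½∫|ω(t)|²η(t)` with `η(t) = annularRamp k (R₁' + σ(t)/c) (R₂' − σ(t)/c) ‖· − x₀‖` is
absolutely continuous on `[0, T]`: `W(t) = Φ(t, σ(t))` with `Φ` Lipschitz on `[0,T] × [0,M]`. [folklore] -/
theorem absolutelyContinuousOnInterval_localisedEnstrophy_movingCutoff (hT : 0 < T)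
    (hw : FluidPDE.IsSmoothSpaceTimeOn (Icc 0 T) w) (hk : 0 ≤ k) (hc : 0 < c) {σ : ℝ → ℝ}
    (hσ : AbsolutelyContinuousOnInterval σ 0 T) {M : ℝ} (hσ0 : ∀ t ∈ Icc 0 T, 0 ≤ σ t)
    (hσM : ∀ t ∈ Icc 0 T, σ t ≤ M) :
    AbsolutelyContinuousOnInterval (fun t => localisedEnstrophy
      (movingCutoff x₀ k (fun t => R₁' + σ t / c) (fun t => R₂' - σ t / c) t) (w t)) 0 T := by
  have hK : IsCompact (Metric.closedBall x₀ R₂') := isCompact_closedBall x₀ R₂'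
  have hR : ∀ r : ℝ, 0 ≤ r → R₂' - r / c ≤ R₂' := fun r hr => by
    have := div_nonneg hr hc.le; linarith
  -- bounds: `|ω| ≤ B` on the slab over the ball, time-Lipschitz constant `L`
  obtain ⟨B, hB⟩ := (IsSmoothSpaceTimeOn.exists_bound (w := fun t x => FluidPDE.curl (w t) x)
    (by exact (hw.fderiv_slice (uniqueDiffOn_Icc hT)).clm FluidPDE.curlCLM) isCompact_Icc hK)
  have hB0 : 0 ≤ max B 0 := le_max_right _ _
  obtain ⟨L, hL0, hL⟩ := exists_lipschitz_localisedEnstrophy_time hT hw hK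
  -- the two-parameter map `Φ (t, r)`
  have hint : ∀ t ∈ Icc 0 T, ∀ r, 0 ≤ r → Integrable fun x => ‖FluidPDE.curl (w t) x‖ ^ 2 *
      movingCutoff x₀ k (fun r => R₁' + r / c) (fun r => R₂' - r / c) r x := by
    intro t ht r hr
    have hcont : Continuous fun x => ‖FluidPDE.curl (w t) x‖ ^ 2 *
        movingCutoff x₀ k (fun r => R₁' + r / c) (fun r => R₂' - r / c) r x :=
      ((FluidPDE.continuous_curl ((hw.contDiff_slice ht).of_le (by norm_cast))).norm.pow 2).mul
        (continuous_movingCutoff_slice hk x₀ _ _ r)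
    exact hcont.integrable_of_hasCompactSupport ((hasCompactSupport_movingCutoff hk).mul_left)
  obtain ⟨L', hL'⟩ : ∃ L' : ℝ,
      L' = L + 1 / 2 * (max B 0 ^ 2 * (k / c)) * (volume (Metric.closedBall x₀ R₂')).toReal :=
    ⟨_, rfl⟩
  have hL'0 : 0 ≤ L' := by rw [hL']; positivity
  have hlip : LipschitzOnWith (Real.toNNReal L')
      (fun q : ℝ × ℝ => localisedEnstrophy
        (movingCutoff x₀ k (fun r => R₁' + r / c) (fun r => R₂' - r / c) q.2) (w q.1))
      (Icc 0 T ×ˢ Icc 0 M) := by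
    refine LipschitzOnWith.of_dist_le_mul fun q hq q' hq' => ?_
    rw [Real.coe_toNNReal _ hL'0, Real.dist_eq]
    have h1 := hL (movingCutoff x₀ k (fun r => R₁' + r / c) (fun r => R₂' - r / c) q.2)
      (continuous_movingCutoff_slice hk x₀ _ _ q.2) (movingCutoff_nonneg x₀ k _ _ q.2)
      (movingCutoff_le_one x₀ k _ _ q.2)
      (fun x hx => movingCutoff_eq_zero_of_not_mem hk fun h' =>
        hx (Metric.closedBall_subset_closedBall (hR q.2 hq.2.1) (Metric.ball_subset_closedBall h'.1)))
      q'.1 hq'.1 q.1 hq.1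
    have h2 := abs_localisedEnstrophy_param_sub_le (x₀ := x₀) (R₁' := R₁') (R₂' := R₂')
      (B := max B 0) hk hc
      (fun x hx => (hB q'.1 hq'.1 x hx).trans (le_max_left B 0)) hq.2.1 hq'.2.1 (hint q'.1 hq'.1)
    have hd1 : |q.1 - q'.1| ≤ dist q q' := by
      rw [← Real.dist_eq, Prod.dist_eq]; exact le_max_left _ _
    have hd2 : |q.2 - q'.2| ≤ dist q q' := by
      rw [← Real.dist_eq, Prod.dist_eq]; exact le_max_right _ _
    calc |localisedEnstrophy (movingCutoff x₀ k (fun r => R₁' + r / c) (fun r => R₂' - r / c) q.2) (w q.1) -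
          localisedEnstrophy (movingCutoff x₀ k (fun r => R₁' + r / c) (fun r => R₂' - r / c) q'.2) (w q'.1)|
        ≤ |localisedEnstrophy (movingCutoff x₀ k (fun r => R₁' + r / c) (fun r => R₂' - r / c) q.2) (w q.1) -
            localisedEnstrophy (movingCutoff x₀ k (fun r => R₁' + r / c) (fun r => R₂' - r / c) q.2) (w q'.1)| +
          |localisedEnstrophy (movingCutoff x₀ k (fun r => R₁' + r / c) (fun r => R₂' - r / c) q.2) (w q'.1) -
            localisedEnstrophy (movingCutoff x₀ k (fun r => R₁' + r / c) (fun r => R₂' - r / c) q'.2) (w q'.1)| :=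
          abs_sub_le _ _ _
      _ ≤ L * |q.1 - q'.1| +
          1 / 2 * (max B 0 ^ 2 * (k / c)) * (volume (Metric.closedBall x₀ R₂')).toReal * |q.2 - q'.2| :=
          add_le_add h1 h2
      _ ≤ L * dist q q' +
          1 / 2 * (max B 0 ^ 2 * (k / c)) * (volume (Metric.closedBall x₀ R₂')).toReal * dist q q' :=
          add_le_add (mul_le_mul_of_nonneg_left hd1 hL0) (mul_le_mul_of_nonneg_left hd2 (by positivity))
      _ = L' * dist q q' := by rw [hL']; ring
  have hcurve : AbsolutelyContinuousOnInterval (fun t : ℝ => (t, σ t)) 0 T :=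
    (absolutelyContinuousOnInterval_id 0 T).prodMk hσ
  have hmaps : MapsTo (fun t : ℝ => (t, σ t)) (uIcc 0 T) (Icc 0 T ×ˢ Icc 0 M) := by
    intro t ht
    rw [uIcc_of_le hT.le] at ht
    exact mk_mem_prod ht ⟨hσ0 t ht, hσM t ht⟩
  -- `W = Φ ∘ (t ↦ (t, σ t))` (unfold the cutoff only; the integrals are untouched)
  have hfun : (fun t => localisedEnstrophy
      (movingCutoff x₀ k (fun t => R₁' + σ t / c) (fun t => R₂' - σ t / c) t) (w t)) =
      (fun q : ℝ × ℝ => localisedEnstrophy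
        (movingCutoff x₀ k (fun r => R₁' + r / c) (fun r => R₂' - r / c) q.2) (w q.1)) ∘
        fun t => (t, σ t) := by
    funext t
    rw [Function.comp_apply]
    congr 1
  rw [hfun]
  exact hlip.comp_absolutelyContinuousOnInterval hcurve hmaps

/-- **The kinematic part of the integrated enstrophy identity (10.11).** Along the speed-driven
cutoff (`σ` absolutely continuous, `0 ≤ σ ≤ M`, `σ' = dσ/dt` a.e. — for the speed integral,
`σ' = ‖u(t)‖_{L^∞}` by `TaoSpeedIntegral.ae_hasDerivAt_speedIntegral` — and a plateau that stays
nonempty), for `0 ≤ s ≤ t ≤ T`: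
`W(t) − W(s) = ∫ₛᵗ ( ∫⟨ω, ∂ₜω⟩(τ)η(τ) − (k/c)σ'(τ)·½∫_{layers(τ)}|ω(τ)|² ) dτ`,
i.e. `W(t) − W(s) = ∫ₛᵗ (production − Y₂)`. The production term is what the vorticity equation and
integration by parts in `x` turn into `−Y₁ + Y₃ + Y₄ + Y₅ + Y₆`. [cite: Tao2011, §10, proof of Thm. 10.1 ((10.11))] -/
theorem localisedEnstrophy_movingCutoff_sub_eq (hT : 0 < T)
    (hw : FluidPDE.IsSmoothSpaceTimeOn (Icc 0 T) w) (hk : 0 < k) (hc : 0 < c) {σ : ℝ → ℝ}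
    (hσ : AbsolutelyContinuousOnInterval σ 0 T) {M : ℝ} (hσ0 : ∀ t ∈ Icc 0 T, 0 ≤ σ t)
    (hσM : ∀ t ∈ Icc 0 T, σ t ≤ M) {σ' : ℝ → ℝ}
    (hσd : ∀ᵐ t, t ∈ Icc 0 T → HasDerivAt σ (σ' t) t)
    (hgap : R₁' + M / c + k⁻¹ < R₂' - M / c - k⁻¹) {s t : ℝ} (hs : 0 ≤ s) (hst : s ≤ t)
    (ht : t ≤ T) :
    localisedEnstrophy (movingCutoff x₀ k (fun t => R₁' + σ t / c) (fun t => R₂' - σ t / c) t) (w t) -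
        localisedEnstrophy (movingCutoff x₀ k (fun t => R₁' + σ t / c) (fun t => R₂' - σ t / c) s)
          (w s) =
      ∫ τ in s..t, ((∫ x, enstrophyProduction T w τ x *
          movingCutoff x₀ k (fun t => R₁' + σ t / c) (fun t => R₂' - σ t / c) τ x) -
        k / c * σ' τ * (1 / 2 * ∫ x in transitionLayers x₀ k c R₁' R₂' (σ τ),
          ‖FluidPDE.curl (w τ) x‖ ^ 2)) := by
  have hW := absolutelyContinuousOnInterval_localisedEnstrophy_movingCutoff (x₀ := x₀) (R₁' := R₁')
    (R₂' := R₂') hT hw hk.le hc hσ hσ0 hσM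
  have hsub : uIcc s t ⊆ uIcc 0 T := by
    rw [uIcc_of_le hst, uIcc_of_le hT.le]; exact Icc_subset_Icc hs ht
  have hftc := (hW.mono hsub).integral_deriv_eq_sub
  rw [← hftc]
  have hσc : ContinuousOn σ (Icc 0 T) := by
    have := hσ.continuousOn; rwa [uIcc_of_le hT.le] at this
  have hneT : ∀ᵐ τ : ℝ, τ ≠ T := by simp [ae_iff, measure_singleton]
  refine intervalIntegral.integral_congr_ae ?_
  filter_upwards [hσd, hneT] with τ hτd hτT hτmem
  rw [uIoc_of_le hst] at hτmem
  have hτI : τ ∈ Ioo 0 T := ⟨hs.trans_lt hτmem.1, lt_of_le_of_ne (hτmem.2.trans ht) hτT⟩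
  have hτIcc : τ ∈ Icc 0 T := Ioo_subset_Icc_self hτI
  have hgapτ : R₁' + σ τ / c + k⁻¹ < R₂' - σ τ / c - k⁻¹ := by
    have h1 : σ τ / c ≤ M / c := div_le_div_of_nonneg_right (hσM τ hτIcc) hc.le
    linarith
  exact (hasDerivAt_localisedEnstrophy_movingCutoff hT hw hk hc hσc hσ0 hτI (hτd hτIcc) hgapτ).deriv

/-- The rate in the integrated identity is interval integrable (it agrees a.e. with the
derivative of the absolutely continuous `W`). [folklore] -/
theorem intervalIntegrable_localisedEnstrophy_rate (hT : 0 < T)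
    (hw : FluidPDE.IsSmoothSpaceTimeOn (Icc 0 T) w) (hk : 0 < k) (hc : 0 < c) {σ : ℝ → ℝ}
    (hσ : AbsolutelyContinuousOnInterval σ 0 T) {M : ℝ} (hσ0 : ∀ t ∈ Icc 0 T, 0 ≤ σ t)
    (hσM : ∀ t ∈ Icc 0 T, σ t ≤ M) {σ' : ℝ → ℝ}
    (hσd : ∀ᵐ t, t ∈ Icc 0 T → HasDerivAt σ (σ' t) t)
    (hgap : R₁' + M / c + k⁻¹ < R₂' - M / c - k⁻¹) {s t : ℝ} (hs : 0 ≤ s) (hst : s ≤ t)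
    (ht : t ≤ T) :
    IntervalIntegrable (fun τ => (∫ x, enstrophyProduction T w τ x *
          movingCutoff x₀ k (fun t => R₁' + σ t / c) (fun t => R₂' - σ t / c) τ x) -
        k / c * σ' τ * (1 / 2 * ∫ x in transitionLayers x₀ k c R₁' R₂' (σ τ),
          ‖FluidPDE.curl (w τ) x‖ ^ 2)) volume s t := by
  have hW := absolutelyContinuousOnInterval_localisedEnstrophy_movingCutoff (x₀ := x₀) (R₁' := R₁')
    (R₂' := R₂') hT hw hk.le hc hσ hσ0 hσM
  have hsub : uIcc s t ⊆ uIcc 0 T := by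
    rw [uIcc_of_le hst, uIcc_of_le hT.le]; exact Icc_subset_Icc hs ht
  have hint := (hW.mono hsub).intervalIntegrable_deriv
  have hσc : ContinuousOn σ (Icc 0 T) := by
    have := hσ.continuousOn; rwa [uIcc_of_le hT.le] at this
  have hneT : ∀ᵐ τ : ℝ, τ ≠ T := by simp [ae_iff, measure_singleton]
  rw [intervalIntegrable_iff_integrableOn_Ioc_of_le hst] at hint ⊢
  refine hint.congr ?_
  refine (ae_restrict_iff' (measurableSet_Ioc : MeasurableSet (Ioc s t))).2 ?_
  filter_upwards [hσd, hneT] with τ hτd hτT hτmem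
  have hτI : τ ∈ Ioo 0 T := ⟨hs.trans_lt hτmem.1, lt_of_le_of_ne (hτmem.2.trans ht) hτT⟩
  have hτIcc : τ ∈ Icc 0 T := Ioo_subset_Icc_self hτI
  have hgapτ : R₁' + σ τ / c + k⁻¹ < R₂' - σ τ / c - k⁻¹ := by
    have h1 : σ τ / c ≤ M / c := div_le_div_of_nonneg_right (hσM τ hτIcc) hc.le
    linarith
  exact (hasDerivAt_localisedEnstrophy_movingCutoff hT hw hk hc hσc hσ0 hτI (hτd hτIcc) hgapτ).deriv

end AbsCont
end Literature.Analysis.FluidPDE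

end
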